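import Summits.KontsevichZagierPeriods.KontsevichZagierPeriods.Theses.HurwitzMicroSectors
import Literature.NumberTheory.Transcendental.BoxCoordinatePowerMap
import Literature.NumberTheory.Transcendental.BoxIntegralZetaValues

/-!
# Disproof of `ReductionTwoSix` — crux stmt-KontsevichZagierPeriods-3871 (route HurwitzMicroSectors, rank 3)

Standing-adversary work file (refuter `cdisprove`; gen 1 / cycle 1 and gen 2 / cycle 2, 2026-08-16).
`lean check`: rc 0, 0 `sorry`, 0 warnings; axioms ⊆ {propext, Classical.choice, Quot.sound}. Imports the route file and two
Literature utilities (`BoxCoordinatePowerMap`, `BoxIntegralZetaValues`) used only in §10.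
Tree copies (same declarations, namespace `Summit.KontsevichZagierPeriods.HurwitzMicroSectors.
ReductionTwoSixNegative`, module prefix `…Theorems.ReductionTwoSix.Negative.`), ALL ACCEPTED:
`Bookkeeping` (p72693, §1), `Kit` (p72898, §2+§5), `Tightness` (p73856, §3–§4), `NonVacuity` (p73864, §6),
`Relative` (p74194, §9). §10 (the proof of the item itself) is NOT landed by the refuter: the prover's
closing file `ReductionTwoSixClose.lean` (imports `Negative.Relative` + the two Literature utilities;
49 lines) and the self-contained `ReductionTwoSixProof.lean` are attached to the item as evidence.

## The crux (definitionally, `reductionTwoSix_iff`)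
every `r : KZ.IntegralRep 2` on the open box `(0,1)²` whose integrand agrees there with
`P(xy)/(1−(xy)⁶)`, `P ∈ ℚ[t]`, is `KZ.Equivalent` to a rep on the same box with integrand
`a + b/(1−xy) + c/(1+xy+x²y²)`, `a b c : ℚ`.

## CYCLE 2 (gen 2; skeleton `line-jacobian-monomials` 99b45435aafb still the registered one, lead PICKED it
01:50Z; payload targets / stuck stubs: none). Re-check against today's tree: this whole file rc 0, 0 sorry,
0 warnings, std axioms — `reductionTwoSix_holds` (§10) and the three verbatim stub proofs (§7) still
kernel-check, so there is STILL NOTHING TO KILL; no prover has landed the closing file yet (no proposal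
targets `…ReductionTwoSix…` outside `Negative/`). New checked content, all NEGATIVE-SIDE load-bearing
analysis of the dilation engine (the one thing the eight idea cards disagree about):
* §11 `no_finite_dilation_engine` / `monomial_not_normalisable` / `monomial_normalisable_by_p`: in the
  bookkeeping model of the POLYNOMIAL part (rule 1b + dilations `U_m F = m² X^(m-1) F(X^m)`), for a prime
  `p` the monomial `X^(p-1)` is equivalent to NO constant unless some exponent used is divisible by `p`
  (fake period `Λ_p`), and ONE move `m = p` suffices. Hence NO FINITE set of exponents normalises all
  polynomial parts: the picked line's `m = k+1` is forced among dilation-only proofs, the Kubert engine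
  `{2,3,6}` never reaches `X⁴ ↔ 1/25`, and a finite engine must use rule 3 (card euler-stokes) instead.
* §12 `kubert_false_without_dil2` / `kubert_false_with_dil2_only` / `bookkeeping_via_u6`: for the RESIDUE
  part the level-3 lift `m = 2` is load-bearing (rational model `ψ = (1,1,0,−1,−1,0)` of `Dil₃(0), Dil₃(1),
  U₆` with no normal form for `P = 1`), `Dil₂` alone is insufficient (`ψ = (3,1,−6,1,3,−2)`), and `U₆`
  replaces `Dil₃(1)` ("level 2 not needed" of card hecke-kernel-certificate, kernel-checked): minimal
  residue engines = `{Dil₂(0),Dil₂(1),Dil₂(2)} + {Dil₃(1) or U₆}`, rank 4.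
* §13 `inSector_finite_engine_fails` (+ soundness `S_R2/S_R3/S_R6/S_RM`, `inSectorSpan_le_ker`): the FULL
  in-sector model on numerators `N ↔ N(t)/(1−t⁶)` — the three Kubert lifts on ALL elements of levels 3, 2, 1
  (`R2`, `R3`, `R6`, each a genuine relation of the KZ quotient) plus any FINITE set `M` of polynomial
  dilations (`RM`) — leaves some monomial integrand `t^k` with NO normal form `nfPoly a b c` (fake period
  of the polynomial part, `LamN p = Λ_p ∘ (· /ₘ (X⁶−1))`, Euclid by `X³−1`, `X²−1`, `X−1` turns each lift
  into `U_2`, `U_3`, `U_6` on the polynomial part). REFUTED STRENGTHENING: "the crux holds by rules 1b + 2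
  inside the sector with finitely many dilation maps". The §9–§10 proof escapes through `m = k+1` only.
* gen-2 cards (euler-stokes-polynomial-descent, cartan-homotopy-dilation; `SketchIdeator3G2.lean`): every
  stated Prop is value-consistent (`EulerStokesDescent`: `∬((tH)')(xy) = ∫H`; `FaceKill`/`HomotopyLift`:
  fibrewise FTC gives value 0 / the boundary difference; `CornerIntegrable`: `∬(1−x)/(1−xy)² = 1`;
  `CartanIdentity` is the transport identity), and every glue `… → ReductionTwoSix` (`FiniteEngine`, all
  `Transfer`s) is now TRIVIALLY TRUE because the conclusion is a theorem (§10) — no attack surface.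
Scope of §11–§13 (honest): statements about the ABSTRACT in-sector move sets, exactly like §1 (§13 proves
the model SOUND — its relations are true KZ relations — not complete); they do not constrain rule 3 or
changes of variables other than `x ↦ x^m`, nor excursions outside the sector.

## VERDICT (cycle 1): NO KILL — the crux is TRUE and PROVED here (`reductionTwoSix_holds : ReductionTwoSix`,
§10, sorry-free, audit proof-of-item closed=true; candidate proof attached to the item as
`ReductionTwoSixProof.lean` for a PROVER to land — a refuter cannot land S). Structure of the proof:
`reductionTwoSix_of_dilationMove : DilationMove → IntegrableOn (1/(1−xy)) box → ReductionTwoSix`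
(§9, sorry-free; sharper: `reductionTwoSix_of_dilationMoveDim` uses only `DilationMoveDim 2`, the `n = 2`
slice, at `m ∈ {2, 3} ∪ {k+1}`; route form `reductionTwoSix_of_route : DilationMove → BoxIntegralZetaTwo →
ReductionTwoSix`). So item 3871 is exactly as true as the `n = 2` slice of item 3872 (`DilationMove`) plus the integrability half of item 3875 (`BoxIntegralZetaTwo`); a prover closes
3871 by `reductionTwoSix_of_dilationMove h3872 h3875.1`. Any refutation of 3871 must refute
`DilationMove` at one of those instances (all classical substitutions `xᵢ ↦ xᵢ^m` on the open box).
* Independently of §9: the ONLY invariant of `KZ.relations` in the tree is evaluation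
  (`KZ.Equivalent.value_eq_holds`). A refutation by soundness must exhibit `P` whose box integral lies
  OUTSIDE `ℚ + ℚ·I₁ + ℚ·I₂` (`I₁ = ∬1/(1−xy) = π²/6`, `I₂ = ∬1/(1+xy+x²y²) = L(2,χ₋₃)`), see
  `falsity_channel`. It never does: `P(t)/(1−t⁶) = Q(t) + Σ_{r<6} p_r t^r/(1−t⁶)`, `∬ t^k = (k+1)⁻²`,
  `∬ t^r/(1−t⁶) = h_r = Σ_j (6j+r+1)⁻²` and (A = Σ(3n+1)⁻², B = Σ(3n+2)⁻², A+B = 8ζ(2)/9, A−B = L):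
  `h₅ = π²/216, h₂ = π²/72, h₁ = π²/54 + L/8, h₃ = π²/54 − L/8, h₀ = π²/18 + 5L/8, h₄ = π²/18 − 5L/8`
  — all in `ℚπ² + ℚL` (job j007874: 60-digit check + PSLQ: no ℤ-relation among `(1, π², L)` to height
  10¹², consistent with CDT 2024). Separating equal-valued reps needs a NEW invariant = route `Neg`.
* Not vacuous (`sector_nonvacuous`: hypothesis class inhabited for EVERY `P`), not trivial (`simp`,
  `aesop`, `exact?` fail on the unfolded goal), elaborates (probe rc 0, `reductionTwoSix_iff`).

## POSITIVE BY-PRODUCT the provers should take (all kernel-checked here)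
* §9 `reductionTwoSix_of_dilationMove` and its parts: `cls`/`cls_eq_iff` (equivalence = equality in
  `FormalRep ⧸ relations`), `cls_add`/`cls_congr`/`cls_zeroRep` (integrand additivity in the quotient),
  the sector hom `S : ℚ[X] →+ Q` (`N ↦ [∬ N(xy)/(1−(xy)⁶)]`), ONE-MOVE lemmas `S_dil2`
  (`[4q t^(2r+1)] = [q t^r(1+t³)]`), `S_dil3` (`[9q t^(3r+2)] = [q t^r(1+t²+t⁴)]`), `S_dil_monomial`
  (`[q(k+1)² t^k] = [q]`), `S_q6_mul` (polynomial part), `S_lowDegree` (level-6 part), explicit normal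
  form `nfPoly a b c` with `a = −Σ_k Q_k/(k+1)²`, `b = bCoeff p`, `c = cCoeff p`, `P = (X⁶−1)Q + R`.
* §1 `bookkeeping`: the abstract reduction in ANY abelian group from the FOUR dilation relations with
  EXPLICIT rational multipliers; NO DIVISION IN THE GROUP (the planner's "no division rule" worry is
  void: scalars ride inside integrands). `dil3_0_redundant`: `Dil₃ (r=0)` follows from the other four.
* SIMPLIFICATION vs the route text: the polynomial part needs NO Newton–Leibniz, no dimension change,
  no closed bands, no null faces: `[t^k] − [(k+1)⁻²]` is ONE dilation (`m = k+1`, `S_dil_monomial`).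

## LOAD-BEARING / TIGHTNESS (§4; refuted variants conditional on `RigidityInput I₁ I₂` = the route's
standing hypotheses `BoxIntegralZetaTwo ∧ BoxIntegralLTwoChiThree ∧ CDT`, `rigidityInput_of_route`)
* `not_reductionTwoSixNoConst` / `NoPole` / `NoCubic`: none of the three basis functions can be dropped
  (witnesses `P = 1−t⁶`, `1+t+…+t⁵`, `1−t+t³−t⁴`); KZ's own `ζ(2)`-normal form `a + b/(1−xy)` is too
  small at level 6 — exactly where CDT's `L(2,χ₋₃)` enters.
* `not_reductionTwoSixInt`: integer coefficients do not suffice (`P = ½(1−t⁶)`).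
* `normalForm_unique`: the TRUE strengthening (uniqueness of `(a,b,c)`, = item RigidityTwoSix).
* Hypotheses actually USED by the proof in §9: `r.domain = box` (dilations preserve the box; for TRUTH
  on other domains the question is transcendence-open — `Li₂` at algebraic points, `log²` terms; PSLQ
  finds no relation of `(1,π²,L,log²2)` or `(1,π²,L,G)` to height 10⁹, j007874; no theorem possible),
  the level `6` (levels `N ∣ 6` are literal sub-cases; level 4 brings Catalan's `G`, level 5 `π²/√5` —
  refuting those variants needs open independence results; no theorem possible).

## Index
§10 DISCHARGE: `dilationMoveDim_two`, `reductionTwoSix_holds` (THE CRUX, PROVED) ·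
§0 probe · §1 bookkeeping · §2 soundness channel (box, `nf`, `RigidityInput`, `nfRep`, `value_of_nf`,
`coeff_unique`) · §5 route hypotheses ⇒ inputs · §3 witnesses · §4 refuted variants · §6 non-vacuity,
crux on normal forms, falsity channel · §9 THE CRUX MODULO `DilationMove` (proved) · §7 TARGETS: the three ACTIVE stubs of skeleton
`line-jacobian-monomials` (99b45435aafb) PROVED verbatim (`stub_boxDilation_holds`,
`stub_polynomialPartByJacobians_holds`, `stub_polarPartLevelSix_holds`) · §11 (cycle 2) no finite
dilation engine (`dilOp`, `Λ_p`, `dilSpan`, `monomial_not_normalisable`, `no_finite_dilation_engine`) ·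
§12 (cycle 2) load-bearing Kubert lifts (`dil3_1_of_u6`, `bookkeeping_via_u6`, `kubert_false_without_dil2`,
`kubert_false_with_dil2_only`) · §13 (cycle 2) full in-sector model (`quot6`, `LamN`, `R2/R3/R6/RM`,
`S_R2/S_R3/S_R6/S_RM`, `inSectorSpan_le_ker`, `inSector_finite_engine_fails`) · §8 near-misses: none.

## HANDOFF for the next cycle
Nothing adversarial is left at 3871: it is PROVED (§10) and the registered stubs are proved verbatim (§7).
(i) the lead (line jacobian-monomials) ports §7/§10 over `Theorems/ReductionTwoSix/Negative/Relative.lean`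
(p74194) — attack only if a re-registered skeleton DEVIATES from the §7 signatures (re-diff the stub list
against `ledger workitem get` → `skeleton.sha`; 99b45435aafb = proved here); (ii) if the lead switches to a
rule-3 line (euler-stokes / cartan-homotopy), the new stubs are Newton–Leibniz statements: value-consistent
(cycle 2 notes above), so attack their SIDE CONDITIONS (semialgebraicity of primitives on the closed band,
`a ≤ b`, continuity at the faces) rather than their values; (iii) tree copies to land/landed:
`Negative/Engines.lean` (§11–§13, cycle 2; imports Negative/Relative) next to Bookkeeping/Kit/Tightness/
NonVacuity/Relative; (iv) untried regimes, all WITHOUT a possible theorem (transcendence-open): other domains,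
levels `N ∤ 6`, algebraic (non-rational) coefficients.
-/

set_option linter.dupNamespace false

namespace Summit.KontsevichZagierPeriods.KontsevichZagierPeriods.Cruxes.ReductionTwoSix.Disproof

open MeasureTheory Set
open Literature.NumberTheory.Transcendental
open Summit.KontsevichZagierPeriods.KontsevichZagierPeriods.Theses.HurwitzMicroSectors

/-! ## §0 Probe: the crux elaborates and is definitionally the displayed signature -/

/-- The crux, unfolded. -/
theorem reductionTwoSix_iff : ReductionTwoSix ↔
    ∀ (r : KZ.IntegralRep 2) (P : Polynomial ℚ), r.domain = {x | ∀ i, x i ∈ Set.Ioo (0:ℝ) 1} →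
      Set.EqOn r.integrand (fun x => Polynomial.aeval (x 0 * x 1) P / (1 - (x 0 * x 1) ^ 6)) r.domain →
      ∃ (a b c : ℚ) (r' : KZ.IntegralRep 2), r'.domain = {x | ∀ i, x i ∈ Set.Ioo (0:ℝ) 1} ∧
        Set.EqOn r'.integrand
          (fun x => (a : ℝ) + b / (1 - x 0 * x 1) + c / (1 + x 0 * x 1 + (x 0 * x 1) ^ 2)) r'.domain ∧
        KZ.Equivalent r r' :=
  Iff.rfl

/-! ## §1 Bookkeeping: the reduction is exact linear algebra over the ℤ-linear group of moves -/

section Bookkeeping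

variable {V : Type*} [AddCommGroup V]

/-- `α(p) = p₃ − p₁ + 5p₄ − 5p₀`: the `H₃`-coordinate of `Σ p_r H_r` modulo the dilation span. -/
def alpha (p : Fin 6 → ℚ) : ℚ := p 3 - p 1 + 5 * p 4 - 5 * p 0

/-- `β(p) = p₅ + 3p₂ + 8p₁ − 8p₄ + 32p₀`: the `H₅`-coordinate of `Σ p_r H_r` modulo the dilation span. -/
def beta (p : Fin 6 → ℚ) : ℚ := p 5 + 3 * p 2 + 8 * p 1 - 8 * p 4 + 32 * p 0

/-- normal-form coefficient of `1/(1+t+t²)`: `c = −α/8`. -/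
def cCoeff (p : Fin 6 → ℚ) : ℚ := - alpha p / 8

/-- normal-form coefficient of `1/(1−t)`: `b = (β+4α)/36`. -/
def bCoeff (p : Fin 6 → ℚ) : ℚ := (beta p + 4 * alpha p) / 36

/-- BOOKKEEPING THEOREM (abstract skeleton of the reduction, ℤ-linear ambient group, ℚ-scalars only
inside the arguments): if `φ r q` stands for the class of the box integral `[q·t^r/(1−t⁶)]`
(`t = xy`) in ANY abelian group, additive in `q` (integrand additivity), and the four dilation
relations `Dil₂ (r = 0,1,2)` and `Dil₃ (r = 1)` hold for every rational scalar, then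
`Σ_r φ r (p r)` equals the class of the normal form `b/(1−t) + c/(1+t+t²)`
(`1/(1−t) = Σ_r t^r/(1−t⁶)`, `1/(1+t+t²) = (1 − t + t³ − t⁴)/(1−t⁶)`) with `b = bCoeff p`,
`c = cCoeff p`. No division in the group is used: the multipliers of the four relations are the
rationals `μ₁ = p₀ − (b+c)`, `μ₂ = p₄ − (b−c)`, `μ₃ = p₂ − b`, `μ₅ = p₁ + 4p₀ − p₄ − 4b − 4c`. -/
theorem bookkeeping (φ : Fin 6 → ℚ →+ V)
    (dil2_0 : ∀ q : ℚ, φ 1 (4 * q) = φ 0 q + φ 3 q)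
    (dil2_1 : ∀ q : ℚ, φ 3 (4 * q) = φ 1 q + φ 4 q)
    (dil2_2 : ∀ q : ℚ, φ 5 (4 * q) = φ 2 q + φ 5 q)
    (dil3_1 : ∀ q : ℚ, φ 5 (9 * q) = φ 1 q + φ 3 q + φ 5 q)
    (p : Fin 6 → ℚ) :
    ∑ r, φ r (p r) =
      ∑ r, φ r (bCoeff p) +
        (φ 0 (cCoeff p) - φ 1 (cCoeff p) + φ 3 (cCoeff p) - φ 4 (cCoeff p)) := by
  -- the four relations as annihilators
  have kill1 : ∀ μ : ℚ, φ 0 μ - φ 1 (4 * μ) + φ 3 μ = 0 := fun μ => by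
    rw [dil2_0]; abel
  have kill2 : ∀ μ : ℚ, φ 1 μ - φ 3 (4 * μ) + φ 4 μ = 0 := fun μ => by
    rw [dil2_1]; abel
  have kill3 : ∀ μ : ℚ, φ 2 μ - φ 5 (3 * μ) = 0 := fun μ => by
    have e : φ 5 (3 * μ) = φ 5 (4 * μ) - φ 5 μ := by
      rw [← map_sub]; congr 1; ring
    rw [e, dil2_2]; abel
  have kill5 : ∀ μ : ℚ, φ 1 μ + φ 3 μ - φ 5 (8 * μ) = 0 := fun μ => by
    have e : φ 5 (8 * μ) = φ 5 (9 * μ) - φ 5 μ := by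
      rw [← map_sub]; congr 1; ring
    rw [e, dil3_1]; abel
  obtain ⟨b, hb⟩ : ∃ b, bCoeff p = b := ⟨_, rfl⟩
  obtain ⟨c, hc⟩ : ∃ c, cCoeff p = c := ⟨_, rfl⟩
  rw [hb, hc]
  obtain ⟨μ1, h1⟩ : ∃ μ : ℚ, μ = p 0 - (b + c) := ⟨_, rfl⟩
  obtain ⟨μ2, h2⟩ : ∃ μ : ℚ, μ = p 4 - (b - c) := ⟨_, rfl⟩
  obtain ⟨μ3, h3⟩ : ∃ μ : ℚ, μ = p 2 - b := ⟨_, rfl⟩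
  obtain ⟨μ5, h5⟩ : ∃ μ : ℚ, μ = p 1 + 4 * p 0 - p 4 - 4 * b - 4 * c := ⟨_, rfl⟩
  have e0 : p 0 = b + c + μ1 := by rw [h1]; ring
  have e4 : p 4 = b - c + μ2 := by rw [h2]; ring
  have e2 : p 2 = b + μ3 := by rw [h3]; ring
  have e1 : p 1 = b - c + (μ2 + μ5 - 4 * μ1) := by rw [h2, h5, h1]; ring
  have e3 : p 3 = b + c + (μ1 + μ5 - 4 * μ2) := by
    rw [h1, h5, h2, ← hc, ← hb]
    simp only [cCoeff, bCoeff, alpha, beta]; ring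
  have e5 : p 5 = b + (-(3 * μ3) - 8 * μ5) := by
    rw [h3, h5, ← hc, ← hb]
    simp only [cCoeff, bCoeff, alpha, beta]; ring
  simp only [Fin.sum_univ_six]
  rw [e0, e1, e2, e3, e4, e5]
  simp only [map_add, map_sub, map_neg]
  have aux : ∀ X Y K : V, K = 0 → X = Y + K → X = Y := by
    intro X Y K hK h; rw [h, hK, add_zero]
  refine aux _ _ _ (show (φ 0 μ1 - φ 1 (4 * μ1) + φ 3 μ1) + (φ 1 μ2 - φ 3 (4 * μ2) + φ 4 μ2) +
      (φ 2 μ3 - φ 5 (3 * μ3)) + (φ 1 μ5 + φ 3 μ5 - φ 5 (8 * μ5)) = 0 by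
    rw [kill1, kill2, kill3, kill5]; abel) ?_
  abel

/-- Consistency (rank) check: the fifth dilation relation `Dil₃ (r = 0)`,
`9H₂ ∼ H₀ + H₂ + H₄`, FOLLOWS from the other four — exactly 4 of the 5 are independent. -/
theorem dil3_0_redundant (φ : Fin 6 → ℚ →+ V)
    (dil2_0 : ∀ q : ℚ, φ 1 (4 * q) = φ 0 q + φ 3 q)
    (dil2_1 : ∀ q : ℚ, φ 3 (4 * q) = φ 1 q + φ 4 q)
    (dil2_2 : ∀ q : ℚ, φ 5 (4 * q) = φ 2 q + φ 5 q)
    (dil3_1 : ∀ q : ℚ, φ 5 (9 * q) = φ 1 q + φ 3 q + φ 5 q) (q : ℚ) :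
    φ 2 (9 * q) = φ 0 q + φ 2 q + φ 4 q := by
  have h2 : ∀ μ : ℚ, φ 2 μ = φ 5 (3 * μ) := fun μ => by
    have e : φ 5 (3 * μ) = φ 5 (4 * μ) - φ 5 μ := by
      rw [← map_sub]; congr 1; ring
    rw [e, dil2_2]; abel
  have h1 : ∀ μ : ℚ, φ 1 μ = φ 5 (8 * μ) - φ 3 μ := fun μ => by
    have e : φ 5 (8 * μ) = φ 5 (9 * μ) - φ 5 μ := by
      rw [← map_sub]; congr 1; ring
    rw [e, dil3_1]; abel
  have h4 : ∀ μ : ℚ, φ 4 μ = φ 3 (5 * μ) - φ 5 (8 * μ) := fun μ => by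
    have e : φ 3 (5 * μ) = φ 3 (4 * μ) + φ 3 μ := by
      rw [← map_add]; congr 1; ring
    rw [e, dil2_1, h1]; abel
  have h0 : ∀ μ : ℚ, φ 0 μ = φ 5 (32 * μ) - φ 3 (5 * μ) := fun μ => by
    have key := dil2_0 μ
    rw [h1] at key
    have e3 : φ 3 (5 * μ) = φ 3 (4 * μ) + φ 3 μ := by
      rw [← map_add]; congr 1; ring
    have e5 : φ 5 (32 * μ) = φ 5 (8 * (4 * μ)) := by congr 1; ring
    rw [e3, e5]
    calc φ 0 μ = (φ 0 μ + φ 3 μ) - φ 3 μ := by abel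
      _ = (φ 5 (8 * (4 * μ)) - φ 3 (4 * μ)) - φ 3 μ := by rw [key]
      _ = _ := by abel
  rw [h2 (9 * q), h2 q, h0 q, h4 q]
  have e : φ 5 (3 * (9 * q)) = φ 5 (32 * q) + φ 5 (3 * q) - φ 5 (8 * q) := by
    rw [← map_add, ← map_sub]; congr 1; ring
  rw [e]; abel

end Bookkeeping

noncomputable section

/-! ## §2 The soundness channel: rigidity inputs, normal-form representations, values -/

/-- The open unit box `(0,1)²`, literally as in the crux. -/
def box : Set (Fin 2 → ℝ) := {x | ∀ i, x i ∈ Set.Ioo (0:ℝ) 1}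

/-- Auxiliary: `box_eq_pi`. [folklore] -/
theorem box_eq_pi : box = Set.pi Set.univ (fun _ : Fin 2 => Set.Ioo (0:ℝ) 1) := by
  ext x; simp [box, Set.mem_pi]

/-- Auxiliary: `measurableSet_box`. [folklore] -/
theorem measurableSet_box : MeasurableSet box := by
  rw [box_eq_pi]; exact MeasurableSet.univ_pi fun _ => measurableSet_Ioo

/-- Auxiliary: `volume_box_toReal`. [folklore] -/
theorem volume_box_toReal : (volume box).toReal = 1 := by
  rw [box_eq_pi, Real.volume_pi_Ioo_toReal (fun _ => zero_le_one)]
  simp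

/-- Auxiliary: `volume_box_ne_top`. [folklore] -/
theorem volume_box_ne_top : volume box ≠ ⊤ := by
  rw [box_eq_pi, Real.volume_pi_Ioo]
  simp

/-- Auxiliary: `volume_real_box`. [folklore] -/
theorem volume_real_box : volume.real box = 1 := by
  rw [measureReal_def, volume_box_toReal]

/-- The open unit box is `ℚ`-semialgebraic (four strict polynomial inequalities). -/
theorem isSemialgebraic_box :
    Literature.ModelTheory.ExponentialFields.IsSemialgebraic ℚ box := by
  have h : box =
      ⋂ j ∈ (Finset.univ : Finset (Fin 2)),
        ({x | 0 < MvPolynomial.aeval x (MvPolynomial.X j : MvPolynomial (Fin 2) ℚ)} ∩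
          {x | 0 < MvPolynomial.aeval x (1 - MvPolynomial.X j : MvPolynomial (Fin 2) ℚ)}) := by
    ext x
    simp [box, sub_pos]
  rw [h]
  exact Literature.ModelTheory.ExponentialFields.IsSemialgebraic.biInter _ _ fun j _ =>
    (Literature.ModelTheory.ExponentialFields.isSemialgebraic_setOf_eval_pos _).inter
      (Literature.ModelTheory.ExponentialFields.isSemialgebraic_setOf_eval_pos _)

/-- Auxiliary: `t_pos`. [folklore] -/
theorem t_pos {x : Fin 2 → ℝ} (hx : x ∈ box) : 0 < x 0 * x 1 :=
  mul_pos (hx 0).1 (hx 1).1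

/-- Auxiliary: `t_lt_one`. [folklore] -/
theorem t_lt_one {x : Fin 2 → ℝ} (hx : x ∈ box) : x 0 * x 1 < 1 :=
  mul_lt_one_of_nonneg_of_lt_one_left (hx 0).1.le (hx 0).2 (hx 1).2.le

/-- Auxiliary: `one_sub_t_ne`. [folklore] -/
theorem one_sub_t_ne {x : Fin 2 → ℝ} (hx : x ∈ box) : 1 - x 0 * x 1 ≠ 0 :=
  (sub_pos.mpr (t_lt_one hx)).ne'

/-- Auxiliary: `one_sub_t6_ne`. [folklore] -/
theorem one_sub_t6_ne {x : Fin 2 → ℝ} (hx : x ∈ box) : 1 - (x 0 * x 1) ^ 6 ≠ 0 :=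
  (sub_pos.mpr (pow_lt_one₀ (t_pos hx).le (t_lt_one hx) (by norm_num))).ne'

/-- Auxiliary: `cubic_ne`. [folklore] -/
theorem cubic_ne {x : Fin 2 → ℝ} (hx : x ∈ box) : 1 + x 0 * x 1 + (x 0 * x 1) ^ 2 ≠ 0 := by
  have := t_pos hx; positivity

/-- The normal-form integrand, literally as in the crux. -/
def nf (a b c : ℚ) : (Fin 2 → ℝ) → ℝ :=
  fun x => (a : ℝ) + b / (1 - x 0 * x 1) + c / (1 + x 0 * x 1 + (x 0 * x 1) ^ 2)

/-- RIGIDITY INPUTS (the route's own standing hypotheses, abstracted): the two basis integrands are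
integrable on the box with integrals `I₁`, `I₂`, and `1, I₁, I₂` are `ℚ`-linearly independent.
The route instantiates `I₁ = π²/6` (`BoxIntegralZetaTwo`), `I₂ = L(2,χ₋₃)`
(`BoxIntegralLTwoChiThree`) and CDT 2024 Thm 1 (`rigidityInput_of_route`). -/
structure RigidityInput (I₁ I₂ : ℝ) : Prop where
  int₁ : IntegrableOn (fun x : Fin 2 → ℝ => 1 / (1 - x 0 * x 1)) box
  val₁ : ∫ x in box, 1 / (1 - x 0 * x 1) = I₁
  int₂ : IntegrableOn (fun x : Fin 2 → ℝ => 1 / (1 + x 0 * x 1 + (x 0 * x 1) ^ 2)) box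
  val₂ : ∫ x in box, 1 / (1 + x 0 * x 1 + (x 0 * x 1) ^ 2) = I₂
  indep : LinearIndependent ℚ ![(1 : ℝ), I₁, I₂]

variable {I₁ I₂ : ℝ}

/-- Auxiliary: `nf_eq_mul`. [folklore] -/
theorem nf_eq_mul (a b c : ℚ) : nf a b c = fun x : Fin 2 → ℝ =>
    (a : ℝ) + (b : ℝ) * (1 / (1 - x 0 * x 1)) + (c : ℝ) * (1 / (1 + x 0 * x 1 + (x 0 * x 1) ^ 2)) := by
  funext x; simp only [nf]; ring

/-- Auxiliary: `integrableOn_nf`. [folklore] -/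
theorem integrableOn_nf (h : RigidityInput I₁ I₂) (a b c : ℚ) : IntegrableOn (nf a b c) box := by
  rw [nf_eq_mul]
  have h0 : IntegrableOn (fun _ : Fin 2 → ℝ => (a : ℝ)) box := integrableOn_const volume_box_ne_top
  exact (h0.add (h.int₁.const_mul (b : ℝ))).add (h.int₂.const_mul (c : ℝ))

/-- The numerator / denominator polynomials exhibiting `nf a b c` as KZ-rational on the box. -/
def nfNum (a b c : ℚ) : MvPolynomial (Fin 2) ℚ :=
  MvPolynomial.C a * (1 - MvPolynomial.X 0 * MvPolynomial.X 1) *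
      (1 + MvPolynomial.X 0 * MvPolynomial.X 1 + (MvPolynomial.X 0 * MvPolynomial.X 1) ^ 2) +
    MvPolynomial.C b * (1 + MvPolynomial.X 0 * MvPolynomial.X 1 + (MvPolynomial.X 0 * MvPolynomial.X 1) ^ 2) +
    MvPolynomial.C c * (1 - MvPolynomial.X 0 * MvPolynomial.X 1)

/-- Auxiliary: `nfDen`. [folklore] -/
def nfDen : MvPolynomial (Fin 2) ℚ :=
  (1 - MvPolynomial.X 0 * MvPolynomial.X 1) *
    (1 + MvPolynomial.X 0 * MvPolynomial.X 1 + (MvPolynomial.X 0 * MvPolynomial.X 1) ^ 2)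

/-- Auxiliary: `aeval_nfDen`. [folklore] -/
theorem aeval_nfDen (x : Fin 2 → ℝ) : MvPolynomial.aeval x nfDen =
    (1 - x 0 * x 1) * (1 + x 0 * x 1 + (x 0 * x 1) ^ 2) := by
  simp [nfDen]

/-- Auxiliary: `aeval_nfNum`. [folklore] -/
theorem aeval_nfNum (a b c : ℚ) (x : Fin 2 → ℝ) : MvPolynomial.aeval x (nfNum a b c) =
    (a : ℝ) * (1 - x 0 * x 1) * (1 + x 0 * x 1 + (x 0 * x 1) ^ 2) +
      (b : ℝ) * (1 + x 0 * x 1 + (x 0 * x 1) ^ 2) + (c : ℝ) * (1 - x 0 * x 1) := by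
  simp [nfNum]

/-- Auxiliary: `nfDen_ne`. [folklore] -/
theorem nfDen_ne (x : Fin 2 → ℝ) (hx : x ∈ box) : MvPolynomial.aeval x nfDen ≠ 0 := by
  rw [aeval_nfDen]; exact mul_ne_zero (one_sub_t_ne hx) (cubic_ne hx)

/-- Auxiliary: `eqOn_nf`. [folklore] -/
theorem eqOn_nf (a b c : ℚ) :
    EqOn (fun x => MvPolynomial.aeval x (nfNum a b c) / MvPolynomial.aeval x nfDen) (nf a b c) box := by
  intro x hx
  have h1 := one_sub_t_ne hx
  have h2 := cubic_ne hx
  simp only [aeval_nfNum, aeval_nfDen, nf]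
  generalize x 0 * x 1 = t at h1 h2 ⊢
  field_simp

/-- The normal-form representation `∫_(0,1)² (a + b/(1−xy) + c/(1+xy+x²y²))` as a `KZ.IntegralRep 2`. -/
def nfRep (h : RigidityInput I₁ I₂) (a b c : ℚ) : KZ.IntegralRep 2 where
  domain := box
  integrand := nf a b c
  isSemialgebraic_domain := isSemialgebraic_box
  isSemialgebraicFunOn_integrand :=
    (isSemialgebraicFunOn_aeval_div_aeval isSemialgebraic_box (nfNum a b c) nfDen nfDen_ne).congr
      (eqOn_nf a b c)
  integrableOn := integrableOn_nf h a b c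

/-- Auxiliary: `nfRep_domain`. [folklore] -/
@[simp] theorem nfRep_domain (h : RigidityInput I₁ I₂) (a b c : ℚ) : (nfRep h a b c).domain = box := rfl

/-- Auxiliary: `nfRep_integrand`. [folklore] -/
@[simp] theorem nfRep_integrand (h : RigidityInput I₁ I₂) (a b c : ℚ) :
    (nfRep h a b c).integrand = nf a b c := rfl

/-- VALUE of any representation on the box whose integrand is a normal form there. -/
theorem value_of_nf (h : RigidityInput I₁ I₂) (r : KZ.IntegralRep 2) {a b c : ℚ}
    (hdom : r.domain = box) (hint : EqOn r.integrand (nf a b c) box) :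
    r.value = a + b * I₁ + c * I₂ := by
  unfold KZ.IntegralRep.value
  rw [hdom, setIntegral_congr_fun measurableSet_box hint, nf_eq_mul]
  have h0 : IntegrableOn (fun _ : Fin 2 → ℝ => (a : ℝ)) box := integrableOn_const volume_box_ne_top
  have h1 : IntegrableOn (fun x : Fin 2 → ℝ => (b : ℝ) * (1 / (1 - x 0 * x 1))) box :=
    h.int₁.const_mul (b : ℝ)
  have h01 : IntegrableOn (fun x : Fin 2 → ℝ => (a : ℝ) + (b : ℝ) * (1 / (1 - x 0 * x 1))) box :=
    h0.add h1
  have h2 : IntegrableOn (fun x : Fin 2 → ℝ => (c : ℝ) * (1 / (1 + x 0 * x 1 + (x 0 * x 1) ^ 2))) box :=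
    h.int₂.const_mul (c : ℝ)
  show ∫ x in box, ((a : ℝ) + (b : ℝ) * (1 / (1 - x 0 * x 1)) +
      (c : ℝ) * (1 / (1 + x 0 * x 1 + (x 0 * x 1) ^ 2))) = _
  rw [integral_add h01 h2, integral_add h0 h1, integral_const_mul, integral_const_mul,
    h.val₁, h.val₂, setIntegral_const, volume_real_box]
  simp

/-- Auxiliary: `value_nfRep`. [folklore] -/
@[simp] theorem value_nfRep (h : RigidityInput I₁ I₂) (a b c : ℚ) :
    (nfRep h a b c).value = a + b * I₁ + c * I₂ :=
  value_of_nf h _ rfl (fun _ _ => rfl)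

/-- RIGIDITY (coefficient comparison): under the inputs, the triple `(a,b,c)` is determined by the
value `a + b I₁ + c I₂`. -/
theorem coeff_unique (h : RigidityInput I₁ I₂) {a b c a' b' c' : ℚ}
    (he : (a : ℝ) + b * I₁ + c * I₂ = a' + b' * I₁ + c' * I₂) : a = a' ∧ b = b' ∧ c = c' := by
  have hli := Fintype.linearIndependent_iff.mp h.indep ![a - a', b - b', c - c'] (by
    simp [Fin.sum_univ_three, Rat.smul_def]
    linear_combination he)
  have h0 := hli 0
  have h1 := hli 1
  have h2 := hli 2
  simp only [Matrix.cons_val_zero, Matrix.cons_val_one, Matrix.head_cons, Matrix.cons_val_two,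
    Matrix.tail_cons, sub_eq_zero] at h0 h1 h2
  exact ⟨h0, h1, h2⟩

/-- Two normal-form representations on the box that are KZ-equivalent have the same coefficients
(soundness of the calculus + rigidity inputs). This is the ONLY refutation channel available
against `ReductionTwoSix`: evaluation is the only invariant of `KZ.relations` proved in the tree. -/
theorem coeff_eq_of_equivalent (h : RigidityInput I₁ I₂) {a b c a' b' c' : ℚ}
    (r r' : KZ.IntegralRep 2) (hdom : r.domain = box) (hint : EqOn r.integrand (nf a b c) box)
    (hdom' : r'.domain = box) (hint' : EqOn r'.integrand (nf a' b' c') box)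
    (heqv : KZ.Equivalent r r') : a = a' ∧ b = b' ∧ c = c' := by
  have hv : r.value = r'.value := KZ.Equivalent.value_eq_holds heqv
  rw [value_of_nf h r hdom hint, value_of_nf h r' hdom' hint'] at hv
  exact coeff_unique h hv


/-! ## §5 The route's own hypotheses supply the rigidity inputs -/

/-- `BoxIntegralZetaTwo ∧ BoxIntegralLTwoChiThree ∧ CDT Thm 1 ⟹ RigidityInput (π²/6) L(2,χ₋₃)`. -/
theorem rigidityInput_of_route (hζ : BoxIntegralZetaTwo) (hL : BoxIntegralLTwoChiThree)
    (hCDT : LinearIndependent ℚ ![(1 : ℝ), Real.pi ^ 2,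
      (∑' n : ℕ, (1 / (3 * (n : ℝ) + 1) ^ 2 - 1 / (3 * (n : ℝ) + 2) ^ 2))]) :
    RigidityInput (Real.pi ^ 2 / 6)
      (∑' n : ℕ, (1 / (3 * (n : ℝ) + 1) ^ 2 - 1 / (3 * (n : ℝ) + 2) ^ 2)) where
  int₁ := hζ.1
  val₁ := hζ.2
  int₂ := hL.1
  val₂ := hL.2
  indep := by
    rw [Fintype.linearIndependent_iff] at hCDT ⊢
    intro g hg i
    have key := hCDT ![g 0, g 1 / 6, g 2] (by
      simp only [Fin.sum_univ_three, Matrix.cons_val_zero, Matrix.cons_val_one, Matrix.head_cons,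
        Matrix.cons_val_two, Matrix.tail_cons, Rat.smul_def] at hg ⊢
      push_cast
      linear_combination hg)
    fin_cases i
    · simpa using key 0
    · have := key 1
      simp at this
      simpa using this
    · simpa using key 2


/-! ## §3 Witness representations inside the crux's hypothesis class

Three members of the sector `P(t)/(1−t⁶)` ARE normal forms (so the crux holds for them by `refl`):
`P = q(1−t⁶)` (constant `q`), `P = 1+t+…+t⁵` (`1/(1−t)`), `P = 1−t+t³−t⁴` (`1/(1+t+t²)`). -/

open Polynomial in
/-- `P = C q · (1 − X⁶)`: integrand `q`. -/
theorem eqOn_const_witness (q : ℚ) :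
    EqOn (nf q 0 0) (fun x : Fin 2 → ℝ =>
      Polynomial.aeval (x 0 * x 1) (C q * (1 - X ^ 6)) / (1 - (x 0 * x 1) ^ 6)) box := by
  intro x hx
  have h6 := one_sub_t6_ne hx
  simp only [nf, Rat.cast_zero, zero_div, add_zero]
  generalize x 0 * x 1 = t at h6 ⊢
  simp only [map_mul, map_sub, map_one, map_pow, Polynomial.aeval_C, Polynomial.aeval_X,
    eq_ratCast]
  rw [mul_div_assoc, div_self h6, mul_one]

open Polynomial in
/-- `P = 1 + X + X² + X³ + X⁴ + X⁵`: integrand `1/(1−t)`. -/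
theorem eqOn_pole_witness :
    EqOn (nf 0 1 0) (fun x : Fin 2 → ℝ =>
      Polynomial.aeval (x 0 * x 1) (1 + X + X ^ 2 + X ^ 3 + X ^ 4 + X ^ 5 : ℚ[X]) /
        (1 - (x 0 * x 1) ^ 6)) box := by
  intro x hx
  have h6 := one_sub_t6_ne hx
  have h1 := one_sub_t_ne hx
  simp only [nf, map_add, map_one, map_pow, Polynomial.aeval_X, Rat.cast_zero, Rat.cast_one,
    zero_div, add_zero, zero_add]
  generalize x 0 * x 1 = t at h1 h6 ⊢
  rw [div_eq_div_iff h1 h6]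
  ring

open Polynomial in
/-- `P = 1 − X + X³ − X⁴`: integrand `1/(1+t+t²)` (since `(1−t+t³−t⁴)(1+t+t²) = 1 − t⁶`). -/
theorem eqOn_cubic_witness :
    EqOn (nf 0 0 1) (fun x : Fin 2 → ℝ =>
      Polynomial.aeval (x 0 * x 1) (1 - X + X ^ 3 - X ^ 4 : ℚ[X]) / (1 - (x 0 * x 1) ^ 6)) box := by
  intro x hx
  have h6 := one_sub_t6_ne hx
  have h2 := cubic_ne hx
  simp only [nf, map_add, map_sub, map_one, map_pow, Polynomial.aeval_X, Rat.cast_zero,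
    Rat.cast_one, zero_div, add_zero, zero_add]
  generalize x 0 * x 1 = t at h2 h6 ⊢
  rw [div_eq_div_iff h2 h6]
  ring

/-! ## §4 Refuted variants (all by the soundness channel, conditional on `RigidityInput`)

Each `def` below is the crux `ReductionTwoSix` with ONE change; each is FALSE under the route's
standing hypotheses. They delimit the statement: the normal form is minimal (no basis function can
be dropped: TIGHTNESS) and its coefficients are genuinely rational (the ℤ-linear group of moves must
carry the rational scalars INSIDE integrands — which `bookkeeping` shows it can). -/

/-- Variant: integer coefficients `a b c : ℤ` in the normal form. -/
def ReductionTwoSixInt : Prop :=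
  ∀ (r : KZ.IntegralRep 2) (P : Polynomial ℚ), r.domain = {x | ∀ i, x i ∈ Set.Ioo (0:ℝ) 1} →
    Set.EqOn r.integrand (fun x => Polynomial.aeval (x 0 * x 1) P / (1 - (x 0 * x 1) ^ 6)) r.domain →
    ∃ (a b c : ℤ) (r' : KZ.IntegralRep 2), r'.domain = {x | ∀ i, x i ∈ Set.Ioo (0:ℝ) 1} ∧
      Set.EqOn r'.integrand
        (fun x => (a : ℝ) + b / (1 - x 0 * x 1) + c / (1 + x 0 * x 1 + (x 0 * x 1) ^ 2)) r'.domain ∧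
      KZ.Equivalent r r'

/-- Variant (tightness): no constant term, normal form `b/(1−xy) + c/(1+xy+x²y²)`. -/
def ReductionTwoSixNoConst : Prop :=
  ∀ (r : KZ.IntegralRep 2) (P : Polynomial ℚ), r.domain = {x | ∀ i, x i ∈ Set.Ioo (0:ℝ) 1} →
    Set.EqOn r.integrand (fun x => Polynomial.aeval (x 0 * x 1) P / (1 - (x 0 * x 1) ^ 6)) r.domain →
    ∃ (b c : ℚ) (r' : KZ.IntegralRep 2), r'.domain = {x | ∀ i, x i ∈ Set.Ioo (0:ℝ) 1} ∧
      Set.EqOn r'.integrand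
        (fun x => (b : ℝ) / (1 - x 0 * x 1) + c / (1 + x 0 * x 1 + (x 0 * x 1) ^ 2)) r'.domain ∧
      KZ.Equivalent r r'

/-- Variant (tightness): no `1/(1−xy)` term, normal form `a + c/(1+xy+x²y²)`. -/
def ReductionTwoSixNoPole : Prop :=
  ∀ (r : KZ.IntegralRep 2) (P : Polynomial ℚ), r.domain = {x | ∀ i, x i ∈ Set.Ioo (0:ℝ) 1} →
    Set.EqOn r.integrand (fun x => Polynomial.aeval (x 0 * x 1) P / (1 - (x 0 * x 1) ^ 6)) r.domain →
    ∃ (a c : ℚ) (r' : KZ.IntegralRep 2), r'.domain = {x | ∀ i, x i ∈ Set.Ioo (0:ℝ) 1} ∧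
      Set.EqOn r'.integrand
        (fun x => (a : ℝ) + c / (1 + x 0 * x 1 + (x 0 * x 1) ^ 2)) r'.domain ∧
      KZ.Equivalent r r'

/-- Variant (tightness): no `1/(1+xy+x²y²)` term, normal form `a + b/(1−xy)` (the "ζ(2)-only"
normal form KZ's own example would suggest). -/
def ReductionTwoSixNoCubic : Prop :=
  ∀ (r : KZ.IntegralRep 2) (P : Polynomial ℚ), r.domain = {x | ∀ i, x i ∈ Set.Ioo (0:ℝ) 1} →
    Set.EqOn r.integrand (fun x => Polynomial.aeval (x 0 * x 1) P / (1 - (x 0 * x 1) ^ 6)) r.domain →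
    ∃ (a b : ℚ) (r' : KZ.IntegralRep 2), r'.domain = {x | ∀ i, x i ∈ Set.Ioo (0:ℝ) 1} ∧
      Set.EqOn r'.integrand (fun x => (a : ℝ) + b / (1 - x 0 * x 1)) r'.domain ∧
      KZ.Equivalent r r'

/-- ℤ-coefficients do NOT suffice: the member `P = ½(1−t⁶)` (integrand `½`) has the unique normal
form `(½, 0, 0)`. -/
theorem not_reductionTwoSixInt (h : RigidityInput I₁ I₂) : ¬ ReductionTwoSixInt := by
  intro H
  obtain ⟨a, b, c, r', hdom', hint', heqv⟩ :=
    H (nfRep h (1/2) 0 0) (Polynomial.C (1/2 : ℚ) * (1 - Polynomial.X ^ 6)) rfl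
      (eqOn_const_witness (1/2))
  have hint'' : EqOn r'.integrand (nf (a : ℚ) (b : ℚ) (c : ℚ)) box := by
    intro x hx
    rw [hint' (hdom' ▸ hx : x ∈ r'.domain)]
    simp [nf]
  obtain ⟨ha, -, -⟩ := coeff_eq_of_equivalent h _ r' rfl (fun _ _ => rfl) hdom' hint'' heqv
  have h2 : (2 : ℚ) * (a : ℚ) = 1 := by rw [← ha]; norm_num
  have h3 : (2 : ℤ) * a = 1 := by exact_mod_cast h2
  omega

/-- TIGHTNESS: the constant cannot be dropped (`P = 1 − t⁶`, value `1 ∉ ℚI₁ + ℚI₂`). -/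
theorem not_reductionTwoSixNoConst (h : RigidityInput I₁ I₂) : ¬ ReductionTwoSixNoConst := by
  intro H
  obtain ⟨b, c, r', hdom', hint', heqv⟩ :=
    H (nfRep h 1 0 0) (Polynomial.C (1 : ℚ) * (1 - Polynomial.X ^ 6)) rfl (eqOn_const_witness 1)
  have hint'' : EqOn r'.integrand (nf 0 b c) box := by
    intro x hx
    rw [hint' (hdom' ▸ hx : x ∈ r'.domain)]
    simp [nf]
  obtain ⟨ha, -, -⟩ := coeff_eq_of_equivalent h _ r' rfl (fun _ _ => rfl) hdom' hint'' heqv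
  exact one_ne_zero ha

/-- TIGHTNESS: the `1/(1−xy)` term cannot be dropped (`P = 1+t+…+t⁵`, value `I₁ = π²/6`). -/
theorem not_reductionTwoSixNoPole (h : RigidityInput I₁ I₂) : ¬ ReductionTwoSixNoPole := by
  intro H
  obtain ⟨a, c, r', hdom', hint', heqv⟩ :=
    H (nfRep h 0 1 0) _ rfl eqOn_pole_witness
  have hint'' : EqOn r'.integrand (nf a 0 c) box := by
    intro x hx
    rw [hint' (hdom' ▸ hx : x ∈ r'.domain)]
    simp [nf]
  obtain ⟨-, hb, -⟩ := coeff_eq_of_equivalent h _ r' rfl (fun _ _ => rfl) hdom' hint'' heqv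
  exact one_ne_zero hb

/-- TIGHTNESS: the `1/(1+xy+x²y²)` term cannot be dropped (`P = 1−t+t³−t⁴`, value `I₂ = L(2,χ₋₃)`):
KZ's `ζ(2)`-only normal form is too small for level 6 — this is exactly where CDT 2024 enters. -/
theorem not_reductionTwoSixNoCubic (h : RigidityInput I₁ I₂) : ¬ ReductionTwoSixNoCubic := by
  intro H
  obtain ⟨a, b, r', hdom', hint', heqv⟩ :=
    H (nfRep h 0 0 1) _ rfl eqOn_cubic_witness
  have hint'' : EqOn r'.integrand (nf a b 0) box := by
    intro x hx
    rw [hint' (hdom' ▸ hx : x ∈ r'.domain)]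
    simp [nf]
  obtain ⟨-, -, hc⟩ := coeff_eq_of_equivalent h _ r' rfl (fun _ _ => rfl) hdom' hint'' heqv
  exact one_ne_zero hc

/-- STRENGTHENING THAT STAYS TRUE (uniqueness half, = item `RigidityTwoSix` abstracted): whatever
normal form the crux produces, its coefficients are pinned by the value. Not refutable. -/
theorem normalForm_unique (h : RigidityInput I₁ I₂) (r : KZ.IntegralRep 2) {a b c a' b' c' : ℚ}
    (r₁ r₂ : KZ.IntegralRep 2) (h₁ : r₁.domain = box) (h₁' : EqOn r₁.integrand (nf a b c) box)
    (h₂ : r₂.domain = box) (h₂' : EqOn r₂.integrand (nf a' b' c') box)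
    (e₁ : KZ.Equivalent r r₁) (e₂ : KZ.Equivalent r r₂) : a = a' ∧ b = b' ∧ c = c' :=
  coeff_eq_of_equivalent h r₁ r₂ h₁ h₁' h₂ h₂' (e₁.symm.trans e₂)

/-! ## §6 Non-vacuity for every `P`, the crux on normal forms, the falsity channel made explicit -/

/-- The crux HOLDS by `refl` on members whose integrand already is a normal form on the box
(a 3-dimensional subfamily: `P = a(1−t⁶) + b(1+t+…+t⁵) + c(1−t+t³−t⁴)`). -/
theorem reductionTwoSix_on_normalForms (r : KZ.IntegralRep 2) {a b c : ℚ}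
    (hdom : r.domain = box) (hint : EqOn r.integrand (nf a b c) box) :
    ∃ (a b c : ℚ) (r' : KZ.IntegralRep 2), r'.domain = {x | ∀ i, x i ∈ Set.Ioo (0:ℝ) 1} ∧
      Set.EqOn r'.integrand
        (fun x => (a : ℝ) + b / (1 - x 0 * x 1) + c / (1 + x 0 * x 1 + (x 0 * x 1) ^ 2)) r'.domain ∧
      KZ.Equivalent r r' :=
  ⟨a, b, c, r, hdom, fun x hx => hint (show x ∈ box from hdom ▸ hx), KZ.Equivalent.refl r⟩

open Polynomial in
/-- Uniform bound for `|P(t)|` on `[0,1]`: the sum of the absolute values of the coefficients. -/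
def coeffBound (P : ℚ[X]) : ℝ := ∑ i ∈ Finset.range (P.natDegree + 1), |(P.coeff i : ℝ)|

open Polynomial in
/-- Auxiliary: `coeffBound_nonneg`. [folklore] -/
theorem coeffBound_nonneg (P : ℚ[X]) : 0 ≤ coeffBound P :=
  Finset.sum_nonneg fun _ _ => abs_nonneg _

open Polynomial in
/-- Auxiliary: `abs_aeval_le`. [folklore] -/
theorem abs_aeval_le (P : ℚ[X]) {t : ℝ} (h0 : 0 ≤ t) (h1 : t ≤ 1) :
    |Polynomial.aeval t P| ≤ coeffBound P := by
  rw [Polynomial.aeval_eq_sum_range, coeffBound]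
  refine (Finset.abs_sum_le_sum_abs _ _).trans (Finset.sum_le_sum fun i _ => ?_)
  rw [Algebra.smul_def, abs_mul, eq_ratCast]
  calc |(P.coeff i : ℝ)| * |t ^ i| ≤ |(P.coeff i : ℝ)| * 1 := by
        gcongr
        rw [abs_of_nonneg (pow_nonneg h0 _)]
        exact pow_le_one₀ h0 h1
    _ = _ := mul_one _

open Polynomial in
/-- The sector integrand `P(xy)/(1−(xy)⁶)`, literally as in the crux. -/
def sectorFun (P : ℚ[X]) : (Fin 2 → ℝ) → ℝ :=
  fun x => Polynomial.aeval (x 0 * x 1) P / (1 - (x 0 * x 1) ^ 6)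

open Polynomial in
/-- Auxiliary: `continuousOn_sectorFun`. [folklore] -/
theorem continuousOn_sectorFun (P : ℚ[X]) : ContinuousOn (sectorFun P) box := by
  have ht : Continuous fun x : Fin 2 → ℝ => x 0 * x 1 := (continuous_apply 0).mul (continuous_apply 1)
  refine ContinuousOn.div ?_ ?_ (fun x hx => one_sub_t6_ne hx)
  · exact ((Polynomial.continuous_aeval P).comp ht).continuousOn
  · exact (continuous_const.sub (ht.pow 6)).continuousOn

open Polynomial in
/-- Every member of the sector is absolutely integrable on the box, given only the integrability of
`1/(1−xy)` there (`|P(t)|/(1−t⁶) ≤ (Σ|coeff|)/(1−t)` on `(0,1)`). -/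
theorem integrableOn_sectorFun
    (hint : IntegrableOn (fun x : Fin 2 → ℝ => 1 / (1 - x 0 * x 1)) box) (P : ℚ[X]) :
    IntegrableOn (sectorFun P) box := by
  refine Integrable.mono' (hint.const_mul (coeffBound P))
    ((continuousOn_sectorFun P).aestronglyMeasurable measurableSet_box) ?_
  refine ae_restrict_of_forall_mem measurableSet_box fun x hx => ?_
  have h0 := t_pos hx
  have h1 := t_lt_one hx
  simp only [sectorFun, norm_div, Real.norm_eq_abs]
  generalize x 0 * x 1 = t at h0 h1 ⊢
  have h6 : 0 < 1 - t ^ 6 := sub_pos.mpr (pow_lt_one₀ h0.le h1 (by norm_num))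
  have hle : 1 - t ≤ 1 - t ^ 6 := by
    have : t ^ 6 ≤ t := pow_le_of_le_one h0.le h1.le (by norm_num)
    linarith
  rw [abs_of_pos h6]
  calc |Polynomial.aeval t P| / (1 - t ^ 6) ≤ coeffBound P / (1 - t ^ 6) := by
        gcongr; exact abs_aeval_le P h0.le h1.le
    _ ≤ coeffBound P / (1 - t) :=
        div_le_div_of_nonneg_left (coeffBound_nonneg P) (sub_pos.mpr h1) hle
    _ = coeffBound P * (1 / (1 - t)) := by ring

open Polynomial in
/-- Numerator of the sector integrand as a `ℚ`-polynomial in two variables. -/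
def sectorNum (P : ℚ[X]) : MvPolynomial (Fin 2) ℚ :=
  Polynomial.aeval (MvPolynomial.X 0 * MvPolynomial.X 1 : MvPolynomial (Fin 2) ℚ) P

/-- Denominator `1 − (X₀X₁)⁶`. -/
def sectorDen : MvPolynomial (Fin 2) ℚ := 1 - (MvPolynomial.X 0 * MvPolynomial.X 1) ^ 6

open Polynomial in
/-- Auxiliary: `aeval_sectorNum`. [folklore] -/
theorem aeval_sectorNum (P : ℚ[X]) (x : Fin 2 → ℝ) :
    MvPolynomial.aeval x (sectorNum P) = Polynomial.aeval (x 0 * x 1) P := by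
  simp only [sectorNum]
  rw [← Polynomial.aeval_algHom_apply]
  simp

/-- Auxiliary: `aeval_sectorDen`. [folklore] -/
theorem aeval_sectorDen (x : Fin 2 → ℝ) : MvPolynomial.aeval x sectorDen = 1 - (x 0 * x 1) ^ 6 := by
  simp [sectorDen]

open Polynomial in
/-- The sector member `∫_(0,1)² P(xy)/(1−(xy)⁶)` as a `KZ.IntegralRep 2` — the hypothesis class of
the crux is INHABITED for every `P` (given `IntegrableOn (1/(1−xy)) box`, item BoxIntegralZetaTwo). -/
def sectorRep (hint : IntegrableOn (fun x : Fin 2 → ℝ => 1 / (1 - x 0 * x 1)) box) (P : ℚ[X]) :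
    KZ.IntegralRep 2 where
  domain := box
  integrand := sectorFun P
  isSemialgebraic_domain := isSemialgebraic_box
  isSemialgebraicFunOn_integrand :=
    (isSemialgebraicFunOn_aeval_div_aeval isSemialgebraic_box (sectorNum P) sectorDen
      (fun x hx => by rw [aeval_sectorDen]; exact one_sub_t6_ne hx)).congr
      (fun x _ => by simp only [aeval_sectorNum, aeval_sectorDen, sectorFun])
  integrableOn := integrableOn_sectorFun hint P

open Polynomial in
/-- NON-VACUITY: for every `P` some representation satisfies the crux's hypotheses. -/
theorem sector_nonvacuous (hint : IntegrableOn (fun x : Fin 2 → ℝ => 1 / (1 - x 0 * x 1)) box)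
    (P : ℚ[X]) : ∃ r : KZ.IntegralRep 2, r.domain = {x | ∀ i, x i ∈ Set.Ioo (0:ℝ) 1} ∧
      Set.EqOn r.integrand (fun x => Polynomial.aeval (x 0 * x 1) P / (1 - (x 0 * x 1) ^ 6)) r.domain :=
  ⟨sectorRep hint P, rfl, fun _ _ => rfl⟩

open Polynomial in
/-- THE FALSITY CHANNEL, made explicit: under the rigidity inputs the crux forces every sector value
into `ℚ + ℚ·I₁ + ℚ·I₂`; a refutation by soundness = a `P` whose box integral is provably outside.
By the Hurwitz bookkeeping (docblock; job j007874) no such `P` exists. -/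
theorem falsity_channel (h : RigidityInput I₁ I₂) (H : ReductionTwoSix) (P : ℚ[X]) :
    ∃ a b c : ℚ, (sectorRep h.int₁ P).value = a + b * I₁ + c * I₂ := by
  obtain ⟨a, b, c, r', hdom', hint', heqv⟩ := H (sectorRep h.int₁ P) P rfl (fun _ _ => rfl)
  refine ⟨a, b, c, ?_⟩
  rw [KZ.Equivalent.value_eq_holds heqv]
  exact value_of_nf h r' hdom' (fun x hx => hint' (show x ∈ r'.domain from hdom'.symm ▸ hx))


/-! ## §9 The crux modulo `DilationMove`:
`DilationMove → IntegrableOn (1/(1−xy)) box → ReductionTwoSix`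

LOAD-BEARING ANALYSIS in its sharpest form: the crux needs NOTHING beyond item DilationMove
(stmt-3872, used at `m = 2`, `m = 3` and `m = k+1`), integrand additivity, and the integrability
half of item BoxIntegralZetaTwo. No Newton–Leibniz move, no domain additivity, no dimension change. -/

section Relative

open Polynomial

/-- The group of formal combinations of representations modulo the KZ moves. -/
abbrev Q : Type := KZ.FormalRep ⧸ KZ.relations

/-- The class of a representation modulo the moves. -/
def cls {n : ℕ} (r : KZ.IntegralRep n) : Q := ((KZ.of r : KZ.FormalRep) : Q)

/-- `KZ.Equivalent` is equality of classes. -/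
theorem cls_eq_iff {n m : ℕ} {r : KZ.IntegralRep n} {r' : KZ.IntegralRep m} :
    cls r = cls r' ↔ KZ.Equivalent r r' := by
  unfold cls KZ.Equivalent
  rw [QuotientAddGroup.eq, ← sub_eq_neg_add, ← neg_sub (KZ.of r) (KZ.of r'), neg_mem_iff]

/-- Integrand additivity, read in the quotient. -/
theorem cls_add {n : ℕ} (r r₁ r₂ : KZ.IntegralRep n) (h₁ : r₁.domain = r.domain)
    (h₂ : r₂.domain = r.domain) (h : EqOn r.integrand (r₁.integrand + r₂.integrand) r.domain) :
    cls r = cls r₁ + cls r₂ := by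
  have hmem : KZ.of r - KZ.of r₁ - KZ.of r₂ ∈ KZ.relations :=
    KZ.integrandAddRel_subset_relations ⟨n, r, r₁, r₂, h₁, h₂, h, rfl⟩
  have h0 : ((KZ.of r - KZ.of r₁ - KZ.of r₂ : KZ.FormalRep) : Q) = 0 :=
    (QuotientAddGroup.eq_zero_iff _).mpr hmem
  rw [QuotientAddGroup.mk_sub, QuotientAddGroup.mk_sub, sub_sub, sub_eq_zero] at h0
  exact h0

/-- The zero representation on the domain of `r`. -/
def zeroRep {n : ℕ} (r : KZ.IntegralRep n) : KZ.IntegralRep n where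
  domain := r.domain
  integrand := 0
  isSemialgebraic_domain := r.isSemialgebraic_domain
  isSemialgebraicFunOn_integrand :=
    (isSemialgebraicFunOn_aeval r.isSemialgebraic_domain (0 : MvPolynomial (Fin n) ℚ)).congr
      (fun x _ => by simp)
  integrableOn := integrableOn_zero

/-- The zero representation is a relation. -/
theorem cls_zeroRep {n : ℕ} (r : KZ.IntegralRep n) : cls (zeroRep r) = 0 := by
  have h := cls_add (zeroRep r) (zeroRep r) (zeroRep r) rfl rfl (fun x _ => by simp [zeroRep])
  exact add_left_cancel (h.symm.trans (add_zero _).symm)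

/-- Two representations with the same domain and integrands agreeing on it have the same class. -/
theorem cls_congr {n : ℕ} (r r₁ : KZ.IntegralRep n) (h₁ : r₁.domain = r.domain)
    (h : EqOn r.integrand r₁.integrand r.domain) : cls r = cls r₁ := by
  have := cls_add r r₁ (zeroRep r) h₁ rfl (fun x hx => by
    simp only [Pi.add_apply, zeroRep, Pi.zero_apply, add_zero]; exact h hx)
  rwa [cls_zeroRep, add_zero] at this

/-- `DilationMove` restricted to ONE dimension `n` (the crux only needs `n = 2`). -/
def DilationMoveDim (n : ℕ) : Prop :=
  ∀ m : ℕ, 1 ≤ m → ∀ (r r' : KZ.IntegralRep n),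
    r.domain = {x | ∀ i, x i ∈ Set.Ioo (0:ℝ) 1} → r'.domain = {x | ∀ i, x i ∈ Set.Ioo (0:ℝ) 1} →
    (∀ x ∈ r.domain, r.integrand x = r'.integrand (fun i => x i ^ m) * ((m : ℝ) ^ n * ∏ i, x i ^ (m - 1))) →
    KZ.of r - KZ.of r' ∈ KZ.changeOfVariablesRel

/-- `DilationMove ↔ ∀ n, DilationMoveDim n` (definitional reshuffling). -/
theorem dilationMove_iff_forall_dim : DilationMove ↔ ∀ n, DilationMoveDim n :=
  ⟨fun h n m hm => h n m hm, fun h n m hm => h n m hm⟩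

variable (hI : IntegrableOn (fun x : Fin 2 → ℝ => 1 / (1 - x 0 * x 1)) box)

/-- Auxiliary: `sectorRep_domain`. -/
@[simp] theorem sectorRep_domain (P : ℚ[X]) : (sectorRep hI P).domain = box := rfl

/-- Auxiliary: `sectorRep_integrand`. -/
@[simp] theorem sectorRep_integrand (P : ℚ[X]) : (sectorRep hI P).integrand = sectorFun P := rfl

/-- Auxiliary: `sectorFun_add`. -/
theorem sectorFun_add (N₁ N₂ : ℚ[X]) (x : Fin 2 → ℝ) :
    sectorFun (N₁ + N₂) x = sectorFun N₁ x + sectorFun N₂ x := by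
  simp only [sectorFun, map_add, add_div]

/-- Auxiliary: `sectorFun_C_mul`. -/
theorem sectorFun_C_mul (q : ℚ) (N : ℚ[X]) (x : Fin 2 → ℝ) :
    sectorFun (C q * N) x = (q : ℝ) * sectorFun N x := by
  simp only [sectorFun, map_mul, Polynomial.aeval_C, eq_ratCast, mul_div_assoc]

/-- The sector map `N ↦ class of ∫_(0,1)² N(xy)/(1−(xy)⁶)`, an additive homomorphism `ℚ[X] →+ Q`
(integrand additivity). -/
def S : ℚ[X] →+ Q :=
  AddMonoidHom.mk' (fun N => cls (sectorRep hI N)) fun N₁ N₂ =>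
    cls_add _ _ _ rfl rfl fun x _ => by
      simp only [sectorRep_integrand, Pi.add_apply, sectorFun_add]

/-- Auxiliary: `S_apply`. -/
theorem S_apply (N : ℚ[X]) : S hI N = cls (sectorRep hI N) := rfl

/-- ONE dilation move between two sector members (from `DilationMove`, `n = 2`). -/
theorem S_dil (hD : DilationMoveDim 2) (m : ℕ) (hm : 1 ≤ m) (N N' : ℚ[X])
    (h : ∀ x ∈ box, sectorFun N x =
      sectorFun N' (fun i => x i ^ m) * ((m : ℝ) ^ 2 * ∏ i, x i ^ (m - 1))) :
    S hI N = S hI N' := by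
  have hmem := KZ.changeOfVariablesRel_subset_relations
    (hD m hm (sectorRep hI N) (sectorRep hI N') rfl rfl h)
  rw [S_apply, S_apply, cls, cls, ← sub_eq_zero, ← QuotientAddGroup.mk_sub]
  exact (QuotientAddGroup.eq_zero_iff _).mpr hmem

/-- Auxiliary: `t_pow_lt_one`. -/
theorem t_pow_lt_one {x : Fin 2 → ℝ} (hx : x ∈ box) {n : ℕ} (hn : n ≠ 0) : (x 0 * x 1) ^ n < 1 :=
  pow_lt_one₀ (t_pos hx).le (t_lt_one hx) hn

/-- `Dil₂`: `[4q·t^(2r+1)/(1−t⁶)] = [q·t^r/(1−t³)] = [q·t^r(1+t³)/(1−t⁶)]`. -/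
theorem S_dil2 (hD : DilationMoveDim 2) (q : ℚ) (r : ℕ) :
    S hI (C (4 * q) * X ^ (2 * r + 1)) = S hI (C q * X ^ r * (1 + X ^ 3)) := by
  refine S_dil hI hD 2 (by norm_num) _ _ fun x hx => ?_
  have h6 := one_sub_t6_ne hx
  have h12 : 1 - (x 0 * x 1) ^ 12 ≠ 0 := (sub_pos.mpr (t_pow_lt_one hx (by norm_num))).ne'
  have hp6 : 1 + (x 0 * x 1) ^ 6 ≠ 0 := by have := t_pos hx; positivity
  simp only [sectorFun, map_mul, map_pow, map_add, map_one, Polynomial.aeval_C,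
    Polynomial.aeval_X, eq_ratCast, Fin.prod_univ_two]
  rw [show (x 0 ^ 2 * x 1 ^ 2) = (x 0 * x 1) ^ 2 by ring,
    show x 0 ^ (2 - 1) * x 1 ^ (2 - 1) = x 0 * x 1 by norm_num]
  generalize x 0 * x 1 = t at h6 h12 hp6 ⊢
  push_cast
  rw [div_mul_eq_mul_div, div_eq_div_iff h6 (by rw [← pow_mul]; exact h12)]
  rw [← pow_mul, ← pow_mul]
  have : (1 : ℝ) - t ^ (2 * 6) = (1 - t ^ 6) * (1 + t ^ 6) := by ring
  rw [this]
  ring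

/-- `Dil₃`: `[9q·t^(3r+2)/(1−t⁶)] = [q·t^r/(1−t²)] = [q·t^r(1+t²+t⁴)/(1−t⁶)]`. -/
theorem S_dil3 (hD : DilationMoveDim 2) (q : ℚ) (r : ℕ) :
    S hI (C (9 * q) * X ^ (3 * r + 2)) = S hI (C q * X ^ r * (1 + X ^ 2 + X ^ 4)) := by
  refine S_dil hI hD 3 (by norm_num) _ _ fun x hx => ?_
  have h6 := one_sub_t6_ne hx
  have h18 : 1 - (x 0 * x 1) ^ 18 ≠ 0 := (sub_pos.mpr (t_pow_lt_one hx (by norm_num))).ne'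
  simp only [sectorFun, map_mul, map_pow, map_add, map_one, Polynomial.aeval_C,
    Polynomial.aeval_X, eq_ratCast, Fin.prod_univ_two]
  rw [show (x 0 ^ 3 * x 1 ^ 3) = (x 0 * x 1) ^ 3 by ring,
    show x 0 ^ (3 - 1) * x 1 ^ (3 - 1) = (x 0 * x 1) ^ 2 by norm_num [mul_pow]]
  generalize x 0 * x 1 = t at h6 h18 ⊢
  push_cast
  rw [div_mul_eq_mul_div, div_eq_div_iff h6 (by rw [← pow_mul]; exact h18)]
  rw [← pow_mul, ← pow_mul, ← pow_mul]
  have : (1 : ℝ) - t ^ (3 * 6) = (1 - t ^ 6) * (1 + t ^ 6 + t ^ 12) := by ring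
  rw [this]
  ring

/-- `Dil_{k+1}` on a constant: `[q(k+1)²·t^k] = [q]` — the polynomial part needs no Newton–Leibniz. -/
theorem S_dil_monomial (hD : DilationMoveDim 2) (q : ℚ) (k : ℕ) :
    S hI (C (q * ((k : ℚ) + 1) ^ 2) * X ^ k * (1 - X ^ 6)) = S hI (C q * (1 - X ^ 6)) := by
  refine S_dil hI hD (k + 1) (Nat.succ_le_succ (Nat.zero_le k)) _ _ fun x hx => ?_
  have h6 := one_sub_t6_ne hx
  have hk6 : 1 - ((x 0 * x 1) ^ (k + 1)) ^ 6 ≠ 0 := by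
    rw [← pow_mul]; exact (sub_pos.mpr (t_pow_lt_one hx (by positivity))).ne'
  simp only [sectorFun, map_mul, map_pow, map_sub, map_add, map_one, Polynomial.aeval_C,
    Polynomial.aeval_X, eq_ratCast, Fin.prod_univ_two, Nat.add_sub_cancel]
  rw [show (x 0 ^ (k + 1) * x 1 ^ (k + 1)) = (x 0 * x 1) ^ (k + 1) by rw [mul_pow],
    show x 0 ^ k * x 1 ^ k = (x 0 * x 1) ^ k by rw [mul_pow]]
  generalize x 0 * x 1 = t at h6 hk6 ⊢
  push_cast
  rw [mul_div_assoc, div_self h6, mul_one, mul_div_assoc, div_self hk6, mul_one]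
  ring

/-- `φ r q = S (q·X^r)`: the six level-6 residue classes as additive families. -/
def phi (r : Fin 6) : ℚ →+ Q := (S hI).comp (Polynomial.monomial (r : ℕ)).toAddMonoidHom

/-- Auxiliary: `phi_apply`. -/
theorem phi_apply (r : Fin 6) (q : ℚ) : phi hI r q = S hI (C q * X ^ (r : ℕ)) := by
  simp [phi, Polynomial.C_mul_X_pow_eq_monomial]

/-- Auxiliary: `S_congr_poly`. -/
theorem S_congr_poly {N N' : ℚ[X]} (h : N = N') : S hI N = S hI N' := by rw [h]

/-- The four dilation hypotheses of `bookkeeping` hold for `phi` (given `DilationMove`). -/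
theorem phi_dil2_0 (hD : DilationMoveDim 2) (q : ℚ) : phi hI 1 (4 * q) = phi hI 0 q + phi hI 3 q := by
  rw [phi_apply, phi_apply, phi_apply, ← map_add]
  have h := S_dil2 hI hD q 0
  refine (S_congr_poly hI ?_).trans (h.trans (S_congr_poly hI ?_))
  · simp
  · simp; ring

/-- Auxiliary: `phi_dil2_1`. -/
theorem phi_dil2_1 (hD : DilationMoveDim 2) (q : ℚ) : phi hI 3 (4 * q) = phi hI 1 q + phi hI 4 q := by
  rw [phi_apply, phi_apply, phi_apply, ← map_add]
  have h := S_dil2 hI hD q 1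
  refine (S_congr_poly hI ?_).trans (h.trans (S_congr_poly hI ?_))
  · simp
  · simp; ring

/-- Auxiliary: `phi_dil2_2`. -/
theorem phi_dil2_2 (hD : DilationMoveDim 2) (q : ℚ) : phi hI 5 (4 * q) = phi hI 2 q + phi hI 5 q := by
  rw [phi_apply, phi_apply, phi_apply, ← map_add]
  have h := S_dil2 hI hD q 2
  refine (S_congr_poly hI ?_).trans (h.trans (S_congr_poly hI ?_))
  · simp
  · simp; ring

/-- Auxiliary: `phi_dil3_1`. -/
theorem phi_dil3_1 (hD : DilationMoveDim 2) (q : ℚ) :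
    phi hI 5 (9 * q) = phi hI 1 q + phi hI 3 q + phi hI 5 q := by
  rw [phi_apply, phi_apply, phi_apply, phi_apply, ← map_add, ← map_add]
  have h := S_dil3 hI hD q 1
  refine (S_congr_poly hI ?_).trans (h.trans (S_congr_poly hI ?_))
  · simp
  · simp; ring

end Relative

section Assembly

open Polynomial

variable (hI : IntegrableOn (fun x : Fin 2 → ℝ => 1 / (1 - x 0 * x 1)) box)

/-- The monic `X⁶ − 1`. -/
def q6 : ℚ[X] := X ^ 6 - C 1

/-- Auxiliary: `q6_monic`. -/
theorem q6_monic : q6.Monic := Polynomial.monic_X_pow_sub_C (1 : ℚ) (by norm_num)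

/-- Auxiliary: `natDegree_q6`. -/
theorem natDegree_q6 : q6.natDegree = 6 := by
  unfold q6; exact Polynomial.natDegree_X_pow_sub_C

/-- Auxiliary: `q6_ne_one`. -/
theorem q6_ne_one : q6 ≠ 1 := fun h => by
  have := congrArg Polynomial.natDegree h
  rw [natDegree_q6, Polynomial.natDegree_one] at this
  exact absurd this (by norm_num)

/-- The constant produced by the polynomial part: `a₀(Q) = Σ_k Q_k/(k+1)²` (`∬(xy)^k = (k+1)⁻²`). -/
def polyConst (Qt : ℚ[X]) : ℚ :=
  ∑ k ∈ Finset.range (Qt.natDegree + 1), Qt.coeff k / ((k : ℚ) + 1) ^ 2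

/-- POLYNOMIAL PART by dilations only: `S ((X⁶−1)·Q) = S (C(−a₀(Q))·(1−X⁶))`. -/
theorem S_q6_mul (hD : DilationMoveDim 2) (Qt : ℚ[X]) :
    S hI (q6 * Qt) = S hI (C (-polyConst Qt) * (1 - X ^ 6)) := by
  conv_lhs => rw [Qt.as_sum_range_C_mul_X_pow, Finset.mul_sum, map_sum]
  have hk : ∀ k ∈ Finset.range (Qt.natDegree + 1),
      S hI (q6 * (C (Qt.coeff k) * X ^ k)) =
        S hI (C (-(Qt.coeff k / ((k : ℚ) + 1) ^ 2)) * (1 - X ^ 6)) := by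
    intro k _
    have hk1 : ((k : ℚ) + 1) ^ 2 ≠ 0 := by positivity
    have e1 : q6 * (C (Qt.coeff k) * X ^ k) =
        -(C (Qt.coeff k / ((k : ℚ) + 1) ^ 2 * ((k : ℚ) + 1) ^ 2) * X ^ k * (1 - X ^ 6)) := by
      rw [div_mul_cancel₀ _ hk1]; unfold q6; simp only [map_one]; ring
    rw [e1, map_neg, S_dil_monomial hI hD, ← map_neg, ← neg_mul, ← Polynomial.C_neg]
  rw [Finset.sum_congr rfl hk, ← map_sum, ← Finset.sum_mul, ← map_sum, polyConst,
    ← Finset.sum_neg_distrib]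

/-- LEVEL-6 PART: for `deg R < 6`, `S R = S (C b·(1+X+…+X⁵) + C c·(1−X+X³−X⁴))` with the
`bookkeeping` coefficients of `p r = R.coeff r`. -/
theorem S_lowDegree (hD : DilationMoveDim 2) (R : ℚ[X]) (hR : R.natDegree < 6) :
    S hI R = S hI (C (bCoeff fun r : Fin 6 => R.coeff r) * (1 + X + X ^ 2 + X ^ 3 + X ^ 4 + X ^ 5) +
      C (cCoeff fun r : Fin 6 => R.coeff r) * (1 - X + X ^ 3 - X ^ 4)) := by
  set p : Fin 6 → ℚ := fun r => R.coeff r with hp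
  have h1 : S hI R = ∑ r : Fin 6, phi hI r (p r) := by
    conv_lhs => rw [R.as_sum_range_C_mul_X_pow' hR, map_sum]
    rw [← Fin.sum_univ_eq_sum_range]
    refine Finset.sum_congr rfl fun r _ => ?_
    rw [phi_apply]
  rw [h1, bookkeeping (phi hI) (phi_dil2_0 hI hD) (phi_dil2_1 hI hD) (phi_dil2_2 hI hD)
    (phi_dil3_1 hI hD) p]
  simp only [Fin.sum_univ_six, phi_apply, ← map_add, ← map_sub]
  congr 1
  simp only [Fin.val_zero, Fin.val_one, Fin.val_two, show ((3 : Fin 6) : ℕ) = 3 from rfl,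
    show ((4 : Fin 6) : ℕ) = 4 from rfl, show ((5 : Fin 6) : ℕ) = 5 from rfl]
  ring

/-- Auxiliary: `sectorFun_oneSubX6`. -/
theorem sectorFun_oneSubX6 {x : Fin 2 → ℝ} (hx : x ∈ box) : sectorFun (1 - X ^ 6) x = 1 := by
  have h6 := one_sub_t6_ne hx
  simp only [sectorFun, map_sub, map_one, map_pow, Polynomial.aeval_X]
  exact div_self h6

/-- Auxiliary: `sectorFun_pole`. -/
theorem sectorFun_pole {x : Fin 2 → ℝ} (hx : x ∈ box) :
    sectorFun (1 + X + X ^ 2 + X ^ 3 + X ^ 4 + X ^ 5) x = 1 / (1 - x 0 * x 1) := by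
  have h6 := one_sub_t6_ne hx
  have h1 := one_sub_t_ne hx
  simp only [sectorFun, map_add, map_one, map_pow, Polynomial.aeval_X]
  generalize x 0 * x 1 = t at h1 h6 ⊢
  rw [div_eq_div_iff h6 h1]
  ring

/-- Auxiliary: `sectorFun_cubic`. -/
theorem sectorFun_cubic {x : Fin 2 → ℝ} (hx : x ∈ box) :
    sectorFun (1 - X + X ^ 3 - X ^ 4) x = 1 / (1 + x 0 * x 1 + (x 0 * x 1) ^ 2) := by
  have h6 := one_sub_t6_ne hx
  have h2 := cubic_ne hx
  simp only [sectorFun, map_add, map_sub, map_one, map_pow, Polynomial.aeval_X]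
  generalize x 0 * x 1 = t at h2 h6 ⊢
  rw [div_eq_div_iff h6 h2]
  ring

/-- The normal-form member of the sector. -/
def nfPoly (a b c : ℚ) : ℚ[X] :=
  C a * (1 - X ^ 6) + C b * (1 + X + X ^ 2 + X ^ 3 + X ^ 4 + X ^ 5) + C c * (1 - X + X ^ 3 - X ^ 4)

/-- Auxiliary: `sectorFun_nfPoly`. -/
theorem sectorFun_nfPoly (a b c : ℚ) {x : Fin 2 → ℝ} (hx : x ∈ box) :
    sectorFun (nfPoly a b c) x =
      (a : ℝ) + b / (1 - x 0 * x 1) + c / (1 + x 0 * x 1 + (x 0 * x 1) ^ 2) := by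
  simp only [nfPoly, sectorFun_add, sectorFun_C_mul, sectorFun_oneSubX6 hx, sectorFun_pole hx,
    sectorFun_cubic hx]
  ring

/-- **The crux modulo its engine.** `DilationMove` (item stmt-3872) and the integrability of
`1/(1−xy)` on the open box (half of item BoxIntegralZetaTwo) imply `ReductionTwoSix`, with the
EXPLICIT normal form `a = −Σ_k Q_k/(k+1)²`, `b = bCoeff p`, `c = cCoeff p` where
`P = (X⁶−1)·Q + R`, `deg R < 6`, `p r = R.coeff r`; the witness `r'` is the sector member
`sectorRep (nfPoly a b c)` itself. Moves used: integrand additivity and the dilations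
`m = 2, 3` (level-6 relations) and `m = k+1` (monomials) — nothing else. -/
theorem reductionTwoSix_of_dilationMoveDim (hD : DilationMoveDim 2)
    (hI : IntegrableOn (fun x : Fin 2 → ℝ => 1 / (1 - x 0 * x 1)) box) : ReductionTwoSix := by
  intro r P hdom hint
  obtain ⟨R, hRdef⟩ : ∃ R : ℚ[X], R = P %ₘ q6 := ⟨_, rfl⟩
  obtain ⟨Qt, hQdef⟩ : ∃ Qt : ℚ[X], Qt = P /ₘ q6 := ⟨_, rfl⟩
  have hP : P = R + q6 * Qt := by rw [hRdef, hQdef, Polynomial.modByMonic_add_div]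
  have hR : R.natDegree < 6 := by
    rw [hRdef, ← natDegree_q6]; exact Polynomial.natDegree_modByMonic_lt P q6_monic q6_ne_one
  refine ⟨-polyConst Qt, bCoeff fun i : Fin 6 => R.coeff i, cCoeff fun i : Fin 6 => R.coeff i,
    sectorRep hI (nfPoly (-polyConst Qt) (bCoeff fun i : Fin 6 => R.coeff i)
      (cCoeff fun i : Fin 6 => R.coeff i)), rfl, fun x hx => sectorFun_nfPoly _ _ _ hx, ?_⟩
  rw [← cls_eq_iff]
  have h1 : cls r = S hI P :=
    cls_congr r (sectorRep hI P) (by rw [hdom]; rfl) hint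
  rw [h1, hP, map_add, S_q6_mul hI hD Qt, S_lowDegree hI hD R hR, ← map_add]
  show S hI _ = S hI _
  congr 1
  unfold nfPoly
  ring

/-- **The crux modulo its engine** (route form): `DilationMove → IntegrableOn (1/(1−xy)) box →
ReductionTwoSix`; only the `n = 2` dilations are used (`reductionTwoSix_of_dilationMoveDim`). -/
theorem reductionTwoSix_of_dilationMove (hD : DilationMove)
    (hI : IntegrableOn (fun x : Fin 2 → ℝ => 1 / (1 - x 0 * x 1)) box) : ReductionTwoSix :=
  reductionTwoSix_of_dilationMoveDim (dilationMove_iff_forall_dim.mp hD 2) hI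

/-- With the route's own support item: `DilationMove → BoxIntegralZetaTwo → ReductionTwoSix`. -/
theorem reductionTwoSix_of_route (hD : DilationMove) (hZ : BoxIntegralZetaTwo) : ReductionTwoSix :=
  reductionTwoSix_of_dilationMove hD hZ.1

end Assembly


/-! ## §10 Discharge: the `n = 2` dilations from the tree API, and the crux itself -/

section Discharge

/-- The `n = 2` slice of `DilationMove`, from `BoxCoordinatePowerMap` (coordinatewise power map on the
open unit box: semialgebraic, differentiable, injective, onto, `|det| = m² ∏ xᵢ^(m−1)`). -/
theorem dilationMoveDim_two : DilationMoveDim 2 := by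
  intro m hm r r' hdom hdom' h
  have hm0 : m ≠ 0 := Nat.one_le_iff_ne_zero.mp hm
  refine ⟨2, r, r', BoxIntegral.coordPow m, BoxIntegral.coordPowDeriv m, ?_, ?_, ?_, ?_, ?_, rfl⟩
  · rw [hdom]
    exact (isSemialgebraicMapOn_aeval isSemialgebraic_box
      (fun j => (MvPolynomial.X j : MvPolynomial (Fin 2) ℚ) ^ m)).congr
      (fun x _ => by funext j; simp [BoxIntegral.coordPow])
  · intro x _
    exact BoxIntegral.hasFDerivWithinAt_coordPow m _ x
  · rw [hdom]
    exact BoxIntegral.injOn_coordPow_box hm0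
  · rw [hdom', hdom]
    exact (BoxIntegral.image_coordPow_box hm0).symm
  · intro x hx
    rw [hdom] at hx
    rw [h x (hdom ▸ hx), BoxIntegral.abs_det_coordPowDeriv hm0 hx]
    rfl

/-- **`ReductionTwoSix` holds** (item stmt-KontsevichZagierPeriods-3871): the crux RESISTS because it
is TRUE. -/
theorem reductionTwoSix_holds : ReductionTwoSix :=
  reductionTwoSix_of_dilationMoveDim dilationMoveDim_two box_integral_one_div_one_sub_mul_two.1

end Discharge

/-! ## §7 Targets = the ACTIVE skeleton `line-jacobian-monomials` (99b45435aafb, 2026-08-16T01:41Z):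
all three stubs are TRUE — proved here verbatim (a refuter cannot kill them; the lead may copy). -/

section Targets

open Polynomial

/-- Auxiliary: `sectorFun_mul_oneSubX6` — a polynomial integrand is the sector member `Q·(1−X⁶)`. -/
theorem sectorFun_mul_oneSubX6 (Q : ℚ[X]) {x : Fin 2 → ℝ} (hx : x ∈ box) :
    sectorFun (Q * (1 - X ^ 6)) x = Polynomial.aeval (x 0 * x 1) Q := by
  have h6 := one_sub_t6_ne hx
  simp only [sectorFun, map_mul, map_sub, map_one, map_pow, Polynomial.aeval_X]
  rw [mul_div_assoc, div_self h6, mul_one]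

/-- TARGET `stub_boxDilation` (verbatim): TRUE — it is `DilationMoveDim 2` (`dilationMoveDim_two`). -/
theorem stub_boxDilation_holds :
    ∀ (m : ℕ), 1 ≤ m → ∀ (r r' : KZ.IntegralRep 2), r.domain = {x | ∀ i, x i ∈ Set.Ioo (0:ℝ) 1} →
      r'.domain = {x | ∀ i, x i ∈ Set.Ioo (0:ℝ) 1} →
      (∀ x ∈ r.domain, r.integrand x = r'.integrand (fun i => x i ^ m) * ((m : ℝ) ^ 2 * ∏ i, x i ^ (m - 1))) →
      KZ.of r - KZ.of r' ∈ KZ.changeOfVariablesRel :=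
  dilationMoveDim_two

/-- TARGET `stub_polynomialPartByJacobians` (verbatim): TRUE — `[Q(xy)] = [Σ_k Q_k/(k+1)²]` by the
dilations `m = k+1` (`S_q6_mul`); the integrability input is the tree theorem
`box_integral_one_div_one_sub_mul_two.1`. -/
theorem stub_polynomialPartByJacobians_holds :
    (∀ (m : ℕ), 1 ≤ m → ∀ (r r' : KZ.IntegralRep 2), r.domain = {x | ∀ i, x i ∈ Set.Ioo (0:ℝ) 1} →
      r'.domain = {x | ∀ i, x i ∈ Set.Ioo (0:ℝ) 1} →
      (∀ x ∈ r.domain, r.integrand x = r'.integrand (fun i => x i ^ m) * ((m : ℝ) ^ 2 * ∏ i, x i ^ (m - 1))) →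
      KZ.of r - KZ.of r' ∈ KZ.changeOfVariablesRel) →
    ∀ (Q : Polynomial ℚ) (r r' : KZ.IntegralRep 2), r.domain = {x | ∀ i, x i ∈ Set.Ioo (0:ℝ) 1} →
      r'.domain = {x | ∀ i, x i ∈ Set.Ioo (0:ℝ) 1} →
      Set.EqOn r.integrand (fun x => Polynomial.aeval (x 0 * x 1) Q) r.domain →
      Set.EqOn r'.integrand
        (fun _ => ((∑ k ∈ Finset.range (Q.natDegree + 1), Q.coeff k / ((k : ℚ) + 1) ^ 2 : ℚ) : ℝ))
        r'.domain →
      KZ.Equivalent r r' := by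
  intro hD Q r r' hdom hdom' hr hr'
  have hI := box_integral_one_div_one_sub_mul_two.1
  rw [← cls_eq_iff]
  have h1 : cls r = S hI (Q * (1 - X ^ 6)) :=
    cls_congr r (sectorRep hI _) (by rw [hdom]; rfl) fun x hx => by
      have hx' : x ∈ box := by rw [hdom] at hx; exact hx
      rw [hr hx, sectorRep_integrand, sectorFun_mul_oneSubX6 Q hx']
  have h2 : S hI (Q * (1 - X ^ 6)) = S hI (C (polyConst Q) * (1 - X ^ 6)) := by
    have e : Q * (1 - X ^ 6) = -(q6 * Q) := by unfold q6; simp only [map_one]; ring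
    rw [e, map_neg, S_q6_mul hI hD Q, ← map_neg, ← neg_mul, ← Polynomial.C_neg, neg_neg]
  have h3 : cls r' = S hI (C (polyConst Q) * (1 - X ^ 6)) :=
    cls_congr r' (sectorRep hI _) (by rw [hdom']; rfl) fun x hx => by
      have hx' : x ∈ box := by rw [hdom'] at hx; exact hx
      rw [hr' hx, sectorRep_integrand, sectorFun_C_mul, sectorFun_oneSubX6 hx', mul_one]
      rfl
  rw [h1, h2, h3]

/-- TARGET `stub_polarPartLevelSix` (verbatim): TRUE — with `b = bCoeff p`, `c = cCoeff p`
(`p r = R.coeff r`), by `S_lowDegree` (dilations `m = 2, 3` + `bookkeeping`). -/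
theorem stub_polarPartLevelSix_holds :
    (∀ (m : ℕ), 1 ≤ m → ∀ (r r' : KZ.IntegralRep 2), r.domain = {x | ∀ i, x i ∈ Set.Ioo (0:ℝ) 1} →
      r'.domain = {x | ∀ i, x i ∈ Set.Ioo (0:ℝ) 1} →
      (∀ x ∈ r.domain, r.integrand x = r'.integrand (fun i => x i ^ m) * ((m : ℝ) ^ 2 * ∏ i, x i ^ (m - 1))) →
      KZ.of r - KZ.of r' ∈ KZ.changeOfVariablesRel) →
    ∀ (R : Polynomial ℚ), R.natDegree < 6 → ∃ b c : ℚ, ∀ (r r' : KZ.IntegralRep 2),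
      r.domain = {x | ∀ i, x i ∈ Set.Ioo (0:ℝ) 1} → r'.domain = {x | ∀ i, x i ∈ Set.Ioo (0:ℝ) 1} →
      Set.EqOn r.integrand (fun x => Polynomial.aeval (x 0 * x 1) R / (1 - (x 0 * x 1) ^ 6)) r.domain →
      Set.EqOn r'.integrand
        (fun x => (b : ℝ) / (1 - x 0 * x 1) + c / (1 + x 0 * x 1 + (x 0 * x 1) ^ 2)) r'.domain →
      KZ.Equivalent r r' := by
  intro hD R hR
  refine ⟨bCoeff fun i : Fin 6 => R.coeff i, cCoeff fun i : Fin 6 => R.coeff i,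
    fun r r' hdom hdom' hr hr' => ?_⟩
  have hI := box_integral_one_div_one_sub_mul_two.1
  rw [← cls_eq_iff]
  have h1 : cls r = S hI R := cls_congr r (sectorRep hI R) (by rw [hdom]; rfl) hr
  have h3 : cls r' = S hI (C (bCoeff fun i : Fin 6 => R.coeff i) * (1 + X + X ^ 2 + X ^ 3 + X ^ 4 + X ^ 5) +
      C (cCoeff fun i : Fin 6 => R.coeff i) * (1 - X + X ^ 3 - X ^ 4)) :=
    cls_congr r' (sectorRep hI _) (by rw [hdom']; rfl) fun x hx => by
      have hx' : x ∈ box := by rw [hdom'] at hx; exact hx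
      rw [hr' hx, sectorRep_integrand, sectorFun_add, sectorFun_C_mul, sectorFun_C_mul,
        sectorFun_pole hx', sectorFun_cubic hx']
      ring
  rw [h1, S_lowDegree hI hD R hR, h3]

end Targets

/-! ## §11 (cycle 2) NO FINITE DILATION ENGINE for the polynomial part — the `m = k+1` of the
picked line is forced (within rules 1b + 2-dilations), and every prime must divide some exponent used

The bookkeeping model of the polynomial part of the sector: polynomial integrands `F(xy)` on the fixed
open box, modulo integrand additivity (built in: we work in the additive group `ℚ[X]` itself) and the
dilation moves `t ↦ t^m`, which act on integrands by `U_m F = m²·X^(m-1)·F(X^m)` (`aeval_dilOp`: this IS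
the integrand identity of `DilationMoveDim 2` / stub_boxDilation between two polynomial members, cf.
`S_dil`, `S_dil_monomial`). NEGATIVE COUNTERPART of §1 `bookkeeping`:

* `monomial_not_normalisable`: for a prime `p`, modulo additivity and ALL dilations `U_m` with `p ∤ m`,
  the monomial `X^(p-1)` is NOT equivalent to ANY constant (fake period functional `Λ_p`,
  `Λ_p(X^k) = [p ∣ k+1]/(k+1)²`, invariant under every `U_m` with `p ∤ m`, zero on constants,
  `Λ_p(X^(p-1)) = 1/p²`). `monomial_normalisable_by_p`: ONE dilation `m = p` does it (tight).
* `no_finite_dilation_engine`: for every FINITE set `M` of exponents some monomial `X^k` is not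
  normalisable — a dilation-only proof of the crux for all `P` must use unboundedly many distinct
  exponents (the picked line's `m = k+1`, one per monomial, is therefore not a convenience), and the
  in-sector engine `{2, 3, 6}` of the Kubert relations never touches `X⁴ ↔ 1/25` (`p = 5`; this is the
  triage panel's "fake-weight necessity", now kernel-checked for all primes at once).
* Scope (honest): this is a statement about the ABSTRACT move set {rule 1b on the box, rule 2 at the
  dilations `x ↦ x^m`} read on the sector, exactly like §1; it says nothing against rule 3 (card
  euler-stokes-polynomial-descent normalises the polynomial part by Newton–Leibniz with NO dilation) or
  against other changes of variables. Extending `Λ_p` by `0` on the residue part `Σ ρ_r t^r/(1−t⁶)`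
  kills the five Kubert vectors too (they have zero polynomial part), so for `p ≥ 5` the whole in-sector
  model with exponents coprime to `p` fails the crux at `P = X^(p-1)·(1 − X⁶)`. -/

section NoFiniteEngine

open Polynomial

/-- The dilation `t ↦ t^m` read on a polynomial integrand `F(xy)` on the box `(0,1)²`:
`U_m F = m² · X^(m-1) · F(X^m)` (Jacobian factor `m²(xy)^(m-1)`), as an additive endomorphism. -/
noncomputable def dilOp (m : ℕ) : ℚ[X] →+ ℚ[X] :=
  AddMonoidHom.mk' (fun F => C ((m : ℚ) ^ 2) * X ^ (m - 1) * expand ℚ m F) fun F G => by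
    simp only [map_add, mul_add]

/-- Auxiliary: `dilOp_apply`. -/
theorem dilOp_apply (m : ℕ) (F : ℚ[X]) :
    dilOp m F = C ((m : ℚ) ^ 2) * X ^ (m - 1) * expand ℚ m F := rfl

/-- DICTIONARY: `(U_m F)(t) = m² t^(m-1) F(t^m)` — the integrand relation of the dilation move
`x ↦ (x₀^m, x₁^m)` between the box representations of `U_m F (xy)` and `F(xy)` (`t = xy`,
`|det| = m² (x₀x₁)^(m-1)`), i.e. the hypothesis of `S_dil` / `DilationMoveDim 2`. -/
theorem aeval_dilOp (m : ℕ) (F : ℚ[X]) (t : ℝ) :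
    aeval t (dilOp m F) = (m : ℝ) ^ 2 * t ^ (m - 1) * aeval (t ^ m) F := by
  simp only [dilOp_apply, map_mul, map_pow, aeval_C, aeval_X, expand_aeval, eq_ratCast]
  push_cast; ring

/-- `U_m` on monomials: `U_m (a X^k) = m² a · X^(m(k+1)−1)`. -/
theorem dilOp_monomial {m : ℕ} (hm : 1 ≤ m) (k : ℕ) (a : ℚ) :
    dilOp m (monomial k a) = monomial (m * (k + 1) - 1) ((m : ℚ) ^ 2 * a) := by
  rw [dilOp_apply, expand_monomial, C_mul_X_pow_eq_monomial, monomial_mul_monomial]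
  have hmk : 1 ≤ m * (k + 1) := Nat.one_le_iff_ne_zero.mpr (Nat.mul_ne_zero (by omega) (by omega))
  have e : m - 1 + k * m = m * (k + 1) - 1 := by zify [hm, hmk]; ring
  rw [e]

/-- The fake weight `wt p k = [p ∣ k+1] / (k+1)²` (the true weight is `1/(k+1)² = ∬ (xy)^k`). -/
def wt (p k : ℕ) : ℚ := if p ∣ k + 1 then 1 / ((k : ℚ) + 1) ^ 2 else 0

/-- The fake period functional `Λ_p (Σ a_k X^k) = Σ_k a_k · wt p k`. -/
noncomputable def Lam (p : ℕ) : ℚ[X] →+ ℚ :=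
  (lsum (fun k => wt p k • (LinearMap.id : ℚ →ₗ[ℚ] ℚ)) : ℚ[X] →ₗ[ℚ] ℚ).toAddMonoidHom

/-- Auxiliary: `Lam_monomial`. -/
theorem Lam_monomial (p k : ℕ) (a : ℚ) : Lam p (monomial k a) = wt p k * a := by
  simp [Lam, lsum_apply, sum_monomial_index]

/-- Auxiliary: `Lam_C`. -/
theorem Lam_C (p : ℕ) (a : ℚ) : Lam p (C a) = wt p 0 * a := by
  rw [← monomial_zero_left, Lam_monomial]

/-- Auxiliary: `Lam_X_pow`. -/
theorem Lam_X_pow (p k : ℕ) : Lam p (X ^ k) = wt p k := by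
  rw [X_pow_eq_monomial, Lam_monomial, mul_one]

/-- INVARIANCE: `Λ_p ∘ U_m = Λ_p` whenever `p` is prime and `p ∤ m` (`Λ_p` is a model of rule 1b +
all dilations with exponent coprime to `p`). -/
theorem Lam_dilOp {p m : ℕ} (hp : p.Prime) (hm : 1 ≤ m) (hpm : ¬ p ∣ m) (F : ℚ[X]) :
    Lam p (dilOp m F) = Lam p F := by
  suffices h : (Lam p).comp (dilOp m) = Lam p from DFunLike.congr_fun h F
  refine Polynomial.addHom_ext fun k a => ?_
  rw [AddMonoidHom.comp_apply, dilOp_monomial hm, Lam_monomial, Lam_monomial]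
  have hmk : 1 ≤ m * (k + 1) := Nat.one_le_iff_ne_zero.mpr (Nat.mul_ne_zero (by omega) (by omega))
  have hcast : ((m * (k + 1) - 1 : ℕ) : ℚ) + 1 = (m : ℚ) * ((k : ℚ) + 1) := by
    rw [Nat.cast_sub hmk]; push_cast; ring
  have hdvd : (p ∣ m * (k + 1) - 1 + 1) ↔ (p ∣ k + 1) := by
    rw [Nat.sub_add_cancel hmk, hp.dvd_mul]
    exact ⟨fun h => h.resolve_left hpm, Or.inr⟩
  unfold wt
  rw [hcast]
  by_cases hk : p ∣ k + 1
  · rw [if_pos (hdvd.mpr hk), if_pos hk]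
    have : (m : ℚ) ≠ 0 := by exact_mod_cast (show m ≠ 0 by omega)
    field_simp
  · rw [if_neg (fun h => hk (hdvd.mp h)), if_neg hk, zero_mul, zero_mul]

/-- `Λ_p` kills every constant (`p` prime, so `p ∤ 1`). -/
theorem Lam_C_eq_zero {p : ℕ} (hp : p.Prime) (a : ℚ) : Lam p (C a) = 0 := by
  rw [Lam_C, wt, if_neg (by simpa using hp.ne_one), zero_mul]

/-- `Λ_p (X^(p-1)) = 1/p²` (the TRUE value — but `Λ_p` of the matching constant is `0`). -/
theorem Lam_X_pow_pred {p : ℕ} (hp : p.Prime) : Lam p (X ^ (p - 1)) = 1 / (p : ℚ) ^ 2 := by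
  rw [Lam_X_pow, wt, Nat.sub_add_cancel hp.one_lt.le, if_pos dvd_rfl, Nat.cast_sub hp.one_lt.le]
  push_cast; ring

/-- The span of the dilation relations `U_m F − F`, `m ∈ M`, inside the additive group `ℚ[X]` of
polynomial integrands on the box (integrand additivity is built into the ambient group). -/
noncomputable def dilSpan (M : Set ℕ) : AddSubgroup ℚ[X] :=
  AddSubgroup.closure {G | ∃ m ∈ M, ∃ F : ℚ[X], G = dilOp m F - F}

/-- `Λ_p` vanishes on the span of the dilations with exponents coprime to `p`. -/
theorem Lam_eq_zero_of_mem_dilSpan {p : ℕ} (hp : p.Prime) {M : Set ℕ}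
    (hM : ∀ m ∈ M, 1 ≤ m ∧ ¬ p ∣ m) {G : ℚ[X]} (hG : G ∈ dilSpan M) : Lam p G = 0 := by
  refine (AddSubgroup.closure_le (K := (Lam p).ker)).mpr ?_ hG
  rintro _ ⟨m, hm, F, rfl⟩
  rw [SetLike.mem_coe, AddMonoidHom.mem_ker, map_sub, Lam_dilOp hp (hM m hm).1 (hM m hm).2, sub_self]

/-- PRIME NO-GO (refuted strengthening "dilations with exponents coprime to `p` suffice"): modulo
additivity and all `U_m` with `p ∤ m`, the monomial `X^(p-1)` is equivalent to NO constant. For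
`p = 5` this is the in-sector statement: the Kubert engine `{2, 3, 6}` never reaches `X⁴ ↔ 1/25`. -/
theorem monomial_not_normalisable {p : ℕ} (hp : p.Prime) {M : Set ℕ}
    (hM : ∀ m ∈ M, 1 ≤ m ∧ ¬ p ∣ m) (a : ℚ) : X ^ (p - 1) - C a ∉ dilSpan M := fun h => by
  have := Lam_eq_zero_of_mem_dilSpan hp hM h
  rw [map_sub, Lam_X_pow_pred hp, Lam_C_eq_zero hp, sub_zero] at this
  exact absurd this (by have := hp.pos; positivity)

/-- TIGHT: one dilation with exponent `m = p` normalises `X^(p-1)` (`U_p (1/p²) = X^(p-1)`; this is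
`S_dil_monomial` with `k + 1 = p`). -/
theorem monomial_normalisable_by_p {p : ℕ} (hp : 1 ≤ p) :
    X ^ (p - 1) - C (1 / (p : ℚ) ^ 2) ∈ dilSpan {p} := by
  have h : dilOp p (C (1 / (p : ℚ) ^ 2)) - C (1 / (p : ℚ) ^ 2) =
      X ^ (p - 1) - C (1 / (p : ℚ) ^ 2) := by
    rw [← monomial_zero_left, dilOp_monomial hp, monomial_zero_left]
    have : (p : ℚ) ≠ 0 := by exact_mod_cast (show p ≠ 0 by omega)
    rw [show (p : ℚ) ^ 2 * (1 / (p : ℚ) ^ 2) = 1 by field_simp, Nat.zero_add, Nat.mul_one,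
      ← X_pow_eq_monomial]
  rw [← h]
  exact AddSubgroup.subset_closure ⟨p, rfl, _, rfl⟩

/-- NO FINITE DILATION ENGINE: for every finite set `M` of exponents there is a monomial `X^k`
(`k = p − 1`, `p` a prime exceeding `max M`) equivalent to NO constant modulo additivity + the
`M`-dilations. Any dilation-only normalisation of ALL polynomial parts uses infinitely many exponents. -/
theorem no_finite_dilation_engine (M : Finset ℕ) (hM : ∀ m ∈ M, 1 ≤ m) :
    ∃ k : ℕ, ∀ a : ℚ, X ^ k - C a ∉ dilSpan (M : Set ℕ) := by
  obtain ⟨p, hpgt, hp⟩ := Nat.exists_infinite_primes (M.sup id + 1)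
  refine ⟨p - 1, fun a => monomial_not_normalisable hp (fun m hm => ⟨hM m hm, fun hdvd => ?_⟩) a⟩
  have h1 : m ≤ M.sup id := Finset.le_sup (f := id) hm
  have h2 : p ≤ m := Nat.le_of_dvd (hM m hm) hdvd
  omega

end NoFiniteEngine

/-! ## §12 (cycle 2) WHICH KUBERT LIFTS ARE LOAD-BEARING for the residue part (models in `ℚ`)

In the notation of §1 (`φ r q` = class of `[q·t^r/(1−t⁶)]`, any abelian group): the in-sector
dilations are `Dil₂ (r = 0,1,2)` (level `3 → 6`, `m = 2`), `Dil₃ (r = 0,1)` (level `2 → 6`, `m = 3`)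
and `U₆` (level `1 → 6`, `m = 6`: `[36q·t⁵/(1−t⁶)] = [q/(1−t)] = Σ_r [q·t^r/(1−t⁶)]`).
* `dil3_1_of_u6`, `bookkeeping_via_u6` (+): `U₆` REPLACES `Dil₃ (r = 1)` — the level-2 lift (`m = 3`)
  is dispensable (this is card hecke-kernel-certificate's "level 2 not needed", now kernel-checked).
* `kubert_false_without_dil2` (−): the level-3 lift (`m = 2`) is LOAD-BEARING: the rational model
  `φ r q = ψ_r q`, `ψ = (1, 1, 0, −1, −1, 0)` satisfies `Dil₃ (0)`, `Dil₃ (1)` and `U₆`, yet `P = 1`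
  (`[1/(1−t⁶)]`, `φ 0 1 = 1`) equals NO normal-form class `Σ_r φ r b + (φ 0 c − φ 1 c + φ 3 c − φ 4 c)`
  (all `= 0`). So ANY in-sector proof uses the `m = 2` dilation.
* `kubert_false_with_dil2_only` (−): `Dil₂ (0,1,2)` alone do not suffice either
  (`ψ = (3, 1, −6, 1, 3, −2)`), so one of `Dil₃ (1)` / `U₆` is needed: the minimal residue engines are
  exactly `{Dil₂(0), Dil₂(1), Dil₂(2)} + {Dil₃(1) or U₆}` (rank 4 = 6 − 2, cf. `dil3_0_redundant`). -/

section KubertEngine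

variable {V : Type*} [AddCommGroup V]

/-- `U₆` on level 1 (`φ 5 (36q) = Σ_r φ r q`) implies `Dil₃ (r = 1)` given the three `Dil₂`. -/
theorem dil3_1_of_u6 (φ : Fin 6 → ℚ →+ V)
    (dil2_0 : ∀ q : ℚ, φ 1 (4 * q) = φ 0 q + φ 3 q)
    (dil2_1 : ∀ q : ℚ, φ 3 (4 * q) = φ 1 q + φ 4 q)
    (dil2_2 : ∀ q : ℚ, φ 5 (4 * q) = φ 2 q + φ 5 q)
    (u6 : ∀ q : ℚ, φ 5 (36 * q) = ∑ r, φ r q) (q : ℚ) :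
    φ 5 (9 * q) = φ 1 q + φ 3 q + φ 5 q := by
  have hsum : ∀ μ : ℚ, ∑ r, φ r μ = φ 1 (4 * μ) + φ 3 (4 * μ) + φ 5 (4 * μ) := fun μ => by
    simp only [Fin.sum_univ_six]
    rw [dil2_0, dil2_1, dil2_2]
    abel
  have key : ∀ μ : ℚ, φ 1 (4 * μ) + φ 3 (4 * μ) = φ 5 (32 * μ) := fun μ => by
    have h := u6 μ
    rw [hsum] at h
    have e : φ 5 (32 * μ) = φ 5 (36 * μ) - φ 5 (4 * μ) := by rw [← map_sub]; congr 1; ring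
    rw [e, h]; abel
  have k := key (q / 4)
  rw [show 4 * (q / 4) = q by ring, show 32 * (q / 4) = 8 * q by ring] at k
  have e : φ 5 (9 * q) = φ 5 (8 * q) + φ 5 q := by rw [← map_add]; congr 1; ring
  rw [e, ← k]

/-- BOOKKEEPING WITHOUT THE LEVEL-2 LIFT: the three `Dil₂` and `U₆` already give the normal form of
§1 (same coefficients `bCoeff`, `cCoeff`). -/
theorem bookkeeping_via_u6 (φ : Fin 6 → ℚ →+ V)
    (dil2_0 : ∀ q : ℚ, φ 1 (4 * q) = φ 0 q + φ 3 q)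
    (dil2_1 : ∀ q : ℚ, φ 3 (4 * q) = φ 1 q + φ 4 q)
    (dil2_2 : ∀ q : ℚ, φ 5 (4 * q) = φ 2 q + φ 5 q)
    (u6 : ∀ q : ℚ, φ 5 (36 * q) = ∑ r, φ r q) (p : Fin 6 → ℚ) :
    ∑ r, φ r (p r) =
      ∑ r, φ r (bCoeff p) +
        (φ 0 (cCoeff p) - φ 1 (cCoeff p) + φ 3 (cCoeff p) - φ 4 (cCoeff p)) :=
  bookkeeping φ dil2_0 dil2_1 dil2_2 (dil3_1_of_u6 φ dil2_0 dil2_1 dil2_2 u6) p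

/-- The rational model killing `Dil₃ (0)`, `Dil₃ (1)`, `U₆` and every normal form, but not `[1/(1−t⁶)]`. -/
def psiNoDil2 : Fin 6 → ℚ := ![1, 1, 0, -1, -1, 0]

/-- THE LEVEL-3 LIFT (`m = 2`) IS LOAD-BEARING: a model of `Dil₃ (r = 0)`, `Dil₃ (r = 1)` and `U₆` in
which `P = 1` has no normal form. -/
theorem kubert_false_without_dil2 : ∃ φ : Fin 6 → ℚ →+ ℚ,
    (∀ q : ℚ, φ 2 (9 * q) = φ 0 q + φ 2 q + φ 4 q) ∧
    (∀ q : ℚ, φ 5 (9 * q) = φ 1 q + φ 3 q + φ 5 q) ∧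
    (∀ q : ℚ, φ 5 (36 * q) = ∑ r, φ r q) ∧
    ¬ ∃ b c : ℚ, φ 0 1 = ∑ r, φ r b + (φ 0 c - φ 1 c + φ 3 c - φ 4 c) := by
  refine ⟨fun r => AddMonoidHom.mulLeft (psiNoDil2 r), fun q => ?_, fun q => ?_, fun q => ?_, ?_⟩
  · simp [psiNoDil2]
  · simp [psiNoDil2]
  · simp [psiNoDil2, Fin.sum_univ_six]
  · rintro ⟨b, c, h⟩
    simp [psiNoDil2, Fin.sum_univ_six] at h

/-- The rational model killing the three `Dil₂` and every normal form, but not `[1/(1−t⁶)]`. -/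
def psiDil2Only : Fin 6 → ℚ := ![3, 1, -6, 1, 3, -2]

/-- `Dil₂ (0,1,2)` ALONE DO NOT SUFFICE: a model of the three `Dil₂` in which `P = 1` has no normal
form (so `Dil₃ (1)` or `U₆` is needed on top). -/
theorem kubert_false_with_dil2_only : ∃ φ : Fin 6 → ℚ →+ ℚ,
    (∀ q : ℚ, φ 1 (4 * q) = φ 0 q + φ 3 q) ∧
    (∀ q : ℚ, φ 3 (4 * q) = φ 1 q + φ 4 q) ∧
    (∀ q : ℚ, φ 5 (4 * q) = φ 2 q + φ 5 q) ∧
    ¬ ∃ b c : ℚ, φ 0 1 = ∑ r, φ r b + (φ 0 c - φ 1 c + φ 3 c - φ 4 c) := by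
  refine ⟨fun r => AddMonoidHom.mulLeft (psiDil2Only r), fun q => ?_, fun q => ?_, fun q => ?_, ?_⟩
  · simp [psiDil2Only]; ring
  · simp [psiDil2Only]; ring
  · simp [psiDil2Only]; ring
  · rintro ⟨b, c, h⟩
    simp [psiDil2Only, Fin.sum_univ_six] at h
    linarith

end KubertEngine

/-! ## §13 (cycle 2) THE FULL IN-SECTOR MODEL WITH A FINITE POLYNOMIAL ENGINE FAILS THE CRUX

Numerator bookkeeping of the whole sector: `N ∈ ℚ[X]` stands for the integrand `N(t)/(1−t⁶)`, `t = xy`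
(so `X^k(1−X⁶)` is the monomial integrand `t^k`, `sectorFun_mul_oneSubX6`, and `nfPoly a b c` is the
normal form, `sectorFun_nfPoly`). The in-sector moves, as subfamilies of `ℚ[X]`:
`R2 L = 4X·L(X²) − L(1+X³)` (the level-3 lift `m = 2` applied to `L/(1−t³)`, ALL `L`),
`R3 K = 9X²K(X³) − K(1+X²+X⁴)` (level-2 lift `m = 3`, all `K`), `R6 F = 36X⁵F(X⁶) − F(1+X+⋯+X⁵)`
(level-1 lift `m = 6`, all `F`), `RM m F = (U_m F − F)(1−X⁶)` (dilation `m ∈ M` on the polynomial `F`).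
SOUNDNESS (`S_R2`, `S_R3`, `S_R6`, `S_RM`, `inSectorSpan_le_ker`): each is a genuine relation of the
KZ quotient (`S hI (R… ) = 0` from `DilationMoveDim 2`), so `inSectorSpan M` is an honest sub-theory.
NO-GO (`inSector_finite_engine_fails`): for every FINITE `M` there is `k` (`= p − 1`, `p` prime
`> max M + 6`) such that `X^k(1−X⁶) − nfPoly a b c ∉ inSectorSpan M` for ALL `a b c` — the fake period
`Λ_p` of the polynomial part (`LamN p N = Λ_p (N /ₘ (X⁶−1))`, additive by uniqueness of Euclidean
division) kills all four families (`LamN_R2/R3/R6/RM`: Euclid by `X³−1`, `X²−1`, `X−1` moves the lift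
onto the polynomial part, where it is `U_2`, `U_3`, `U_6`) and every normal form, but not `t^(p-1)`.
So: rules 1b + 2 restricted to the sector with finitely many dilation maps CANNOT prove `ReductionTwoSix`;
the true proof (§9–§10) escapes exactly by the unbounded family `m = k+1`; a finite engine needs rule 3. -/

section InSector

open Polynomial

variable (hI : IntegrableOn (fun x : Fin 2 → ℝ => 1 / (1 - x 0 * x 1)) box)

/-- Auxiliary: `degree_q6`. -/
theorem degree_q6 : q6.degree = 6 := by
  rw [degree_eq_natDegree q6_monic.ne_zero, natDegree_q6]; rfl

/-- Minus the polynomial part of `N/(1−t⁶)`: the quotient of the numerator `N` by `X⁶ − 1`. -/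
noncomputable def quot6 (N : ℚ[X]) : ℚ[X] := N /ₘ q6

/-- Uniqueness of Euclidean division, packaged. -/
theorem quot6_of_split {N A R : ℚ[X]} (h : R + q6 * A = N) (hR : R.natDegree ≤ 5) : quot6 N = A := by
  refine (div_modByMonic_unique A R q6_monic ⟨h, ?_⟩).1
  rw [degree_q6]
  exact (degree_le_of_natDegree_le hR).trans_lt (by exact_mod_cast (by norm_num : (5:ℕ) < 6))

/-- `quot6` is additive. -/
theorem quot6_add (N₁ N₂ : ℚ[X]) : quot6 (N₁ + N₂) = quot6 N₁ + quot6 N₂ := by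
  refine (div_modByMonic_unique (N₁ /ₘ q6 + N₂ /ₘ q6) (N₁ %ₘ q6 + N₂ %ₘ q6) q6_monic ⟨?_, ?_⟩).1
  · have h1 := modByMonic_add_div N₁ q6
    have h2 := modByMonic_add_div N₂ q6
    rw [mul_add, add_add_add_comm, h1, h2]
  · exact (degree_add_le _ _).trans_lt
      (max_lt (degree_modByMonic_lt _ q6_monic) (degree_modByMonic_lt _ q6_monic))

/-- The fake period read on numerators: `Λ_p` of (minus) the polynomial part. -/
noncomputable def LamN (p : ℕ) : ℚ[X] →+ ℚ :=
  AddMonoidHom.mk' (fun N => Lam p (quot6 N)) fun N₁ N₂ => by simp only [quot6_add, map_add]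

/-- Auxiliary: `LamN_apply`. -/
theorem LamN_apply (p : ℕ) (N : ℚ[X]) : LamN p N = Lam p (quot6 N) := rfl

/-- Level-3 lift on numerators: `U₂ (L/(1−t³)) − L/(1−t³)`, i.e. `4X·L(X²) − L(1+X³)` over `1 − X⁶`. -/
noncomputable def R2 (L : ℚ[X]) : ℚ[X] := C 4 * X * expand ℚ 2 L - L * (1 + X ^ 3)

/-- Level-2 lift on numerators: `9X²K(X³) − K(1+X²+X⁴)`. -/
noncomputable def R3 (K : ℚ[X]) : ℚ[X] := C 9 * X ^ 2 * expand ℚ 3 K - K * (1 + X ^ 2 + X ^ 4)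

/-- Level-1 lift on numerators: `36X⁵F(X⁶) − F(1+X+⋯+X⁵)`. -/
noncomputable def R6 (F : ℚ[X]) : ℚ[X] :=
  C 36 * X ^ 5 * expand ℚ 6 F - F * (1 + X + X ^ 2 + X ^ 3 + X ^ 4 + X ^ 5)

/-- Dilation `m` on a polynomial integrand `F`, as numerators: `(U_m F − F)(1 − X⁶)`. -/
noncomputable def RM (m : ℕ) (F : ℚ[X]) : ℚ[X] := (dilOp m F - F) * (1 - X ^ 6)

/-- SOUNDNESS of `R2`: a genuine relation of the KZ quotient (one dilation `m = 2`). -/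
theorem S_R2 (hD : DilationMoveDim 2) (L : ℚ[X]) : S hI (R2 L) = 0 := by
  rw [R2, map_sub, sub_eq_zero]
  refine S_dil hI hD 2 (by norm_num) _ _ fun x hx => ?_
  have h6 := one_sub_t6_ne hx
  have h12 : 1 - (x 0 * x 1) ^ 12 ≠ 0 := (sub_pos.mpr (t_pow_lt_one hx (by norm_num))).ne'
  have hp6 : 1 + (x 0 * x 1) ^ 6 ≠ 0 := by have := t_pos hx; positivity
  simp only [sectorFun, map_mul, map_pow, map_add, map_one, Polynomial.aeval_C,
    Polynomial.aeval_X, eq_ratCast, Fin.prod_univ_two, expand_aeval]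
  rw [show (x 0 ^ 2 * x 1 ^ 2) = (x 0 * x 1) ^ 2 by ring,
    show x 0 ^ (2 - 1) * x 1 ^ (2 - 1) = x 0 * x 1 by norm_num]
  generalize x 0 * x 1 = t at h6 h12 hp6 ⊢
  generalize (aeval (t ^ 2)) L = u
  push_cast
  rw [div_mul_eq_mul_div, div_eq_div_iff h6 (by rw [← pow_mul]; exact h12)]
  rw [← pow_mul]
  have : (1 : ℝ) - t ^ (2 * 6) = (1 - t ^ 6) * (1 + t ^ 6) := by ring
  rw [this]
  ring

/-- SOUNDNESS of `R3` (one dilation `m = 3`). -/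
theorem S_R3 (hD : DilationMoveDim 2) (K : ℚ[X]) : S hI (R3 K) = 0 := by
  rw [R3, map_sub, sub_eq_zero]
  refine S_dil hI hD 3 (by norm_num) _ _ fun x hx => ?_
  have h6 := one_sub_t6_ne hx
  have h18 : 1 - (x 0 * x 1) ^ 18 ≠ 0 := (sub_pos.mpr (t_pow_lt_one hx (by norm_num))).ne'
  simp only [sectorFun, map_mul, map_pow, map_add, map_one, Polynomial.aeval_C,
    Polynomial.aeval_X, eq_ratCast, Fin.prod_univ_two, expand_aeval]
  rw [show (x 0 ^ 3 * x 1 ^ 3) = (x 0 * x 1) ^ 3 by ring,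
    show x 0 ^ (3 - 1) * x 1 ^ (3 - 1) = (x 0 * x 1) ^ 2 by norm_num [mul_pow]]
  generalize x 0 * x 1 = t at h6 h18 ⊢
  generalize (aeval (t ^ 3)) K = u
  push_cast
  rw [div_mul_eq_mul_div, div_eq_div_iff h6 (by rw [← pow_mul]; exact h18)]
  rw [← pow_mul, ← pow_mul]
  have : (1 : ℝ) - t ^ (3 * 6) = (1 - t ^ 6) * (1 + t ^ 6 + t ^ 12) := by ring
  rw [this]
  ring

/-- SOUNDNESS of `R6` (one dilation `m = 6`). -/
theorem S_R6 (hD : DilationMoveDim 2) (F : ℚ[X]) : S hI (R6 F) = 0 := by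
  rw [R6, map_sub, sub_eq_zero]
  refine S_dil hI hD 6 (by norm_num) _ _ fun x hx => ?_
  have h1 := one_sub_t_ne hx
  have h6 := one_sub_t6_ne hx
  have h36 : 1 - (x 0 * x 1) ^ 36 ≠ 0 := (sub_pos.mpr (t_pow_lt_one hx (by norm_num))).ne'
  simp only [sectorFun, map_mul, map_pow, map_add, map_one, Polynomial.aeval_C,
    Polynomial.aeval_X, eq_ratCast, Fin.prod_univ_two, expand_aeval]
  rw [show (x 0 ^ 6 * x 1 ^ 6) = (x 0 * x 1) ^ 6 by ring,
    show x 0 ^ (6 - 1) * x 1 ^ (6 - 1) = (x 0 * x 1) ^ 5 by norm_num [mul_pow]]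
  generalize x 0 * x 1 = t at h1 h6 h36 ⊢
  generalize (aeval (t ^ 6)) F = u
  push_cast
  rw [div_mul_eq_mul_div, div_eq_div_iff h6 (by rw [← pow_mul]; exact h36)]
  rw [← pow_mul]
  have : (1 : ℝ) - t ^ (6 * 6) =
      (1 - t ^ 6) * (1 + t ^ 6 + t ^ 12 + t ^ 18 + t ^ 24 + t ^ 30) := by ring
  rw [this]
  have e6 : (1 : ℝ) - t ^ 6 = (1 - t) * (1 + t + t ^ 2 + t ^ 3 + t ^ 4 + t ^ 5) := by ring
  rw [e6]
  ring

/-- SOUNDNESS of `RM` (one dilation `m`, on the polynomial part). -/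
theorem S_RM (hD : DilationMoveDim 2) {m : ℕ} (hm : 1 ≤ m) (F : ℚ[X]) : S hI (RM m F) = 0 := by
  rw [RM, sub_mul, map_sub, sub_eq_zero]
  refine S_dil hI hD m hm _ _ fun x hx => ?_
  have hxm : (fun i => x i ^ m) ∈ box := fun i =>
    ⟨pow_pos (hx i).1 m, pow_lt_one₀ (hx i).1.le (hx i).2 (by omega)⟩
  rw [sectorFun_mul_oneSubX6 _ hx, sectorFun_mul_oneSubX6 _ hxm, aeval_dilOp, Fin.prod_univ_two,
    ← mul_pow, ← mul_pow]
  ring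

/-- The in-sector relation span on numerators: the three Kubert lifts on ALL elements of levels 3, 2, 1
and the dilations with exponents in `M` on polynomial integrands (integrand additivity is the ambient
group law of `ℚ[X]`). -/
noncomputable def inSectorSpan (M : Set ℕ) : AddSubgroup ℚ[X] :=
  AddSubgroup.closure ({G | ∃ L, G = R2 L} ∪ {G | ∃ K, G = R3 K} ∪ {G | ∃ F, G = R6 F} ∪
    {G | ∃ m ∈ M, ∃ F, G = RM m F})

/-- SOUNDNESS of the model: every in-sector relation is a genuine relation of the KZ quotient. -/
theorem inSectorSpan_le_ker (hD : DilationMoveDim 2) {M : Set ℕ} (hM : ∀ m ∈ M, 1 ≤ m) :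
    inSectorSpan M ≤ (S hI).ker := by
  refine (AddSubgroup.closure_le _).mpr ?_
  rintro G (((⟨L, rfl⟩ | ⟨K, rfl⟩) | ⟨F, rfl⟩) | ⟨m, hm, F, rfl⟩) <;>
    rw [SetLike.mem_coe, AddMonoidHom.mem_ker]
  · exact S_R2 hI hD L
  · exact S_R3 hI hD K
  · exact S_R6 hI hD F
  · exact S_RM hI hD (hM m hm) F

/-- Level 3: Euclid by `X³ − 1` moves the lift onto the polynomial part, where it is `U₂`. -/
theorem quot6_R2 (A : ℚ[X]) (a b c : ℚ) :
    quot6 (R2 ((X ^ 3 - 1) * A + (C a + C b * X + C c * X ^ 2))) = dilOp 2 A - A := by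
  refine quot6_of_split (R := C 4 * X * (C a + C b * X ^ 2 + C c * X ^ 4)
      - (C a + C b * X + C c * X ^ 2) * (1 + X ^ 3)) ?_ ?_
  · simp only [R2, dilOp_apply, q6, map_add, map_mul, map_sub, map_pow, expand_C, expand_X, map_one,
      Nat.cast_ofNat, map_ofNat]
    ring
  · compute_degree!

/-- Level 2: Euclid by `X² − 1`. -/
theorem quot6_R3 (B : ℚ[X]) (a b : ℚ) :
    quot6 (R3 ((X ^ 2 - 1) * B + (C a + C b * X))) = dilOp 3 B - B := by
  refine quot6_of_split (R := C 9 * X ^ 2 * (C a + C b * X ^ 3)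
      - (C a + C b * X) * (1 + X ^ 2 + X ^ 4)) ?_ ?_
  · simp only [R3, dilOp_apply, q6, map_add, map_mul, map_sub, map_pow, expand_C, expand_X, map_one,
      Nat.cast_ofNat, map_ofNat]
    ring
  · compute_degree!

/-- Level 1: Euclid by `X − 1`. -/
theorem quot6_R6 (D : ℚ[X]) (a : ℚ) :
    quot6 (R6 ((X - 1) * D + C a)) = dilOp 6 D - D := by
  refine quot6_of_split (R := C 36 * X ^ 5 * C a
      - C a * (1 + X + X ^ 2 + X ^ 3 + X ^ 4 + X ^ 5)) ?_ ?_
  · simp only [R6, dilOp_apply, q6, map_add, map_mul, map_sub, map_pow, expand_C, expand_X, map_one,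
      Nat.cast_ofNat, map_ofNat]
    ring
  · compute_degree!

/-- Auxiliary: `quot6_RM`. -/
theorem quot6_RM (m : ℕ) (F : ℚ[X]) : quot6 (RM m F) = F - dilOp m F := by
  refine quot6_of_split (R := 0) ?_ (by simp)
  simp only [RM, q6, map_one]; ring

/-- Auxiliary: the polynomial part of the monomial integrand `t^k`. -/
theorem quot6_monomial_mul (k : ℕ) : quot6 (X ^ k * (1 - X ^ 6)) = - X ^ k := by
  refine quot6_of_split (R := 0) ?_ (by simp)
  simp only [q6, map_one]; ring

/-- Auxiliary: the polynomial part of a normal form is the constant `a`. -/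
theorem quot6_nfPoly (a b c : ℚ) : quot6 (nfPoly a b c) = - C a := by
  refine quot6_of_split
    (R := C b * (1 + X + X ^ 2 + X ^ 3 + X ^ 4 + X ^ 5) + C c * (1 - X + X ^ 3 - X ^ 4)) ?_ ?_
  · simp only [nfPoly, q6, map_one]; ring
  · compute_degree!

/-- Auxiliary monic / degree facts for the three Euclidean divisions. -/
theorem monic_cub : (X ^ 3 - 1 : ℚ[X]).Monic := by
  simpa using monic_X_pow_sub_C (1 : ℚ) (n := 3) (by norm_num)
/-- Auxiliary: `monic_quad`. -/
theorem monic_quad : (X ^ 2 - 1 : ℚ[X]).Monic := by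
  simpa using monic_X_pow_sub_C (1 : ℚ) (n := 2) (by norm_num)
/-- Auxiliary: `monic_lin`. -/
theorem monic_lin : (X - 1 : ℚ[X]).Monic := by simpa using monic_X_sub_C (1 : ℚ)
/-- Auxiliary: `natDegree_cub`. -/
theorem natDegree_cub : (X ^ 3 - 1 : ℚ[X]).natDegree = 3 := by
  simpa using natDegree_X_pow_sub_C (n := 3) (r := (1 : ℚ))
/-- Auxiliary: `natDegree_quad`. -/
theorem natDegree_quad : (X ^ 2 - 1 : ℚ[X]).natDegree = 2 := by
  simpa using natDegree_X_pow_sub_C (n := 2) (r := (1 : ℚ))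
/-- Auxiliary: `natDegree_lin`. -/
theorem natDegree_lin : (X - 1 : ℚ[X]).natDegree = 1 := by
  simpa using natDegree_X_sub_C (1 : ℚ)

/-- Euclid by a monic `q ≠ 1`: `L = q·(L /ₘ q) + L %ₘ q` with `natDegree (L %ₘ q) < natDegree q`. -/
theorem split_by {q : ℚ[X]} (hq : q.Monic) (hq1 : q ≠ 1) (L : ℚ[X]) :
    q * (L /ₘ q) + L %ₘ q = L ∧ (L %ₘ q).natDegree < q.natDegree :=
  ⟨by rw [add_comm]; exact modByMonic_add_div L q, natDegree_modByMonic_lt L hq hq1⟩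

/-- `Λ_p` kills the level-3 family (`p ≠ 2`). -/
theorem LamN_R2 {p : ℕ} (hp : p.Prime) (hp2 : ¬ p ∣ 2) (L : ℚ[X]) : LamN p (R2 L) = 0 := by
  obtain ⟨hL, hdeg⟩ := split_by monic_cub (fun h => by
    have e := congrArg natDegree h; rw [natDegree_cub, natDegree_one] at e; exact absurd e (by norm_num)) L
  rw [natDegree_cub] at hdeg
  have hrem := as_sum_range' (L %ₘ (X ^ 3 - 1)) 3 hdeg
  simp only [Finset.sum_range_succ, Finset.sum_range_zero, zero_add, ← C_mul_X_pow_eq_monomial,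
    pow_zero, mul_one, pow_one] at hrem
  rw [← hL, hrem, LamN_apply, quot6_R2, map_sub, Lam_dilOp hp (by norm_num) hp2, sub_self]

/-- `Λ_p` kills the level-2 family (`p ≠ 3`). -/
theorem LamN_R3 {p : ℕ} (hp : p.Prime) (hp3 : ¬ p ∣ 3) (K : ℚ[X]) : LamN p (R3 K) = 0 := by
  obtain ⟨hK, hdeg⟩ := split_by monic_quad (fun h => by
    have e := congrArg natDegree h; rw [natDegree_quad, natDegree_one] at e; exact absurd e (by norm_num)) K
  rw [natDegree_quad] at hdeg
  have hrem := as_sum_range' (K %ₘ (X ^ 2 - 1)) 2 hdeg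
  simp only [Finset.sum_range_succ, Finset.sum_range_zero, zero_add, ← C_mul_X_pow_eq_monomial,
    pow_zero, mul_one, pow_one] at hrem
  rw [← hK, hrem, LamN_apply, quot6_R3, map_sub, Lam_dilOp hp (by norm_num) hp3, sub_self]

/-- `Λ_p` kills the level-1 family (`p ∤ 6`). -/
theorem LamN_R6 {p : ℕ} (hp : p.Prime) (hp6 : ¬ p ∣ 6) (F : ℚ[X]) : LamN p (R6 F) = 0 := by
  obtain ⟨hF, hdeg⟩ := split_by monic_lin (fun h => by
    have e := congrArg natDegree h; rw [natDegree_lin, natDegree_one] at e; exact absurd e (by norm_num)) F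
  rw [natDegree_lin] at hdeg
  have hrem := as_sum_range' (F %ₘ (X - 1)) 1 hdeg
  simp only [Finset.sum_range_succ, Finset.sum_range_zero, zero_add, ← C_mul_X_pow_eq_monomial,
    pow_zero, mul_one] at hrem
  rw [← hF, hrem, LamN_apply, quot6_R6, map_sub, Lam_dilOp hp (by norm_num) hp6, sub_self]

/-- `Λ_p` kills the polynomial dilations with `p ∤ m`. -/
theorem LamN_RM {p m : ℕ} (hp : p.Prime) (hm : 1 ≤ m) (hpm : ¬ p ∣ m) (F : ℚ[X]) :
    LamN p (RM m F) = 0 := by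
  rw [LamN_apply, quot6_RM, map_sub, Lam_dilOp hp hm hpm, sub_self]

/-- `Λ_p` kills the whole in-sector span when `p ≥ 7` and `p` divides no exponent of `M`. -/
theorem LamN_eq_zero_of_mem {p : ℕ} (hp : p.Prime) (h7 : 7 ≤ p) {M : Set ℕ}
    (hM : ∀ m ∈ M, 1 ≤ m ∧ ¬ p ∣ m) {G : ℚ[X]} (hG : G ∈ inSectorSpan M) : LamN p G = 0 := by
  have nd : ∀ d : ℕ, 1 ≤ d → d ≤ 6 → ¬ p ∣ d := fun d h1 h6 h =>
    absurd (Nat.le_of_dvd (by omega) h) (by omega)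
  refine (AddSubgroup.closure_le (K := (LamN p).ker)).mpr ?_ hG
  rintro G (((⟨L, rfl⟩ | ⟨K, rfl⟩) | ⟨F, rfl⟩) | ⟨m, hm, F, rfl⟩) <;>
    rw [SetLike.mem_coe, AddMonoidHom.mem_ker]
  · exact LamN_R2 hp (nd 2 (by norm_num) (by norm_num)) L
  · exact LamN_R3 hp (nd 3 (by norm_num) (by norm_num)) K
  · exact LamN_R6 hp (nd 6 (by norm_num) (by norm_num)) F
  · exact LamN_RM hp (hM m hm).1 (hM m hm).2 F

/-- FULL IN-SECTOR NO-GO (refuted strengthening "`ReductionTwoSix` holds inside the sector with a finite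
set of dilation maps"): for every finite set `M` of polynomial dilation exponents there is a monomial
integrand `t^k` (numerator `X^k(1−X⁶)`) with NO normal form `a + b/(1−t) + c/(1+t+t²)` (numerator
`nfPoly a b c`) modulo additivity, the three Kubert lifts on all levels and the `M`-dilations. -/
theorem inSector_finite_engine_fails (M : Finset ℕ) (hM : ∀ m ∈ M, 1 ≤ m) :
    ∃ k : ℕ, ∀ a b c : ℚ, X ^ k * (1 - X ^ 6) - nfPoly a b c ∉ inSectorSpan (M : Set ℕ) := by
  obtain ⟨p, hpgt, hp⟩ := Nat.exists_infinite_primes (M.sup id + 7)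
  refine ⟨p - 1, fun a b c hmem => ?_⟩
  have hM' : ∀ m ∈ (M : Set ℕ), 1 ≤ m ∧ ¬ p ∣ m := fun m hm => ⟨hM m hm, fun hdvd => by
    have h1 : m ≤ M.sup id := Finset.le_sup (f := id) (Finset.mem_coe.mp hm)
    have h2 := Nat.le_of_dvd (hM m hm) hdvd
    omega⟩
  have h := LamN_eq_zero_of_mem hp (by omega) hM' hmem
  rw [map_sub, LamN_apply, LamN_apply, quot6_monomial_mul, quot6_nfPoly, map_neg, map_neg,
    Lam_X_pow_pred hp, Lam_C_eq_zero hp, neg_zero, sub_zero, neg_eq_zero] at h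
  exact absurd h (by have := hp.pos; positivity)

end InSector

/-! ## §8 Near-misses: none — nothing in this file is sorried. -/

end

end Summit.KontsevichZagierPeriods.KontsevichZagierPeriods.Cruxes.ReductionTwoSix.Disproof
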